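import Literature.MathematicalPhysics.QuantumFieldTheory.BalabanImbrieJaffe1984to88.BIJ88InteriorHaarChart
import Literature.MathematicalPhysics.QuantumFieldTheory.BalabanImbrieJaffe1984to88.BIJ88Eq5127GaugeSector
import Mathlib.MeasureTheory.Measure.Haar.Unique

/-!
# `BalabanImbrieJaffe1984to88.BIJ88FreeCoordinates48` — T. Bałaban, J. Imbrie, A. Jaffe, *Effective action and cluster properties of the
abelian Higgs model*, Commun. Math. Phys. **114** (1988) 257–315 [BalabanImbrieJaffe1988], **(4.8)** p. 275 [PDF 19] with **(5.12.3)–(5.12.4)**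
p. 301 [PDF 45]: **THE FREE COORDINATES OF THE δ-CONSTRAINED GAUGE INTEGRAL AND THE CONSTRAINED CHART LAW — the measure-level content of
*"The factors e_k/2π come from the replacement of du^{(k)} with dA^{(k)} for the free variables; for the constrained variables the replacement is
compensated by a removal of the e_k/2π factor from the δ-functions, see (4.6)–(4.8)"*, PROVED for an abstract system of interior bonds, tree
bonds, block-bond constraints and covariant block averages (the torus instantiation is the successor file).**

statement-level skeleton of published theorems with citation tags; proofs where landed; nothing here is a claim about the Yang–Mills mass gap

THE PRINT (verbatim; p. 275 read this session as the image `renders/original-p019-x2.png` of the seat folder, p. 301 as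
`lit-balaban-p02/pages/original-p045-x2.png`).  (4.6)–(4.8): *"Z^{(j)}_{Λ^{(j)c*c}_{10}} = ∫𝒟A_{Λ^{(j)c*c}_{10}} δ_{Ax,Λ^{(j)′}_{10}}(A) δ_{Λ^{(j)′c*c}_{10}}(QΛ^{(j)c*c}_{10}A)
× exp(−½⟨Λ^{(j)c*c}_{10}A, ∂*σ^{L^jη}_{j,loc}∂Λ^{(j)c*c}_{10}A⟩ − E^{(j)}_{k,v}‖Λ^{(j)c*c}_{10}‖), (4.6) where A lies on the L^jη-lattice. The subscript
to 𝒟A indicates where an A-field is integrated; the subscripts to δ_{Ax} and δ(QA) indicate which blocks have axial gauge conditions and which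
block bonds have conditions on QA. […] ‖Λ^{(j)c*c}_{10}‖ = |Λ^{(j)c*c}_{10}| − |Λ^{(j)′}_{10}|(L^d − 1) − |Λ^{(j)′c*c}_{10}|. (4.8) Here ‖Λ^{(j)c*c}_{10}‖ is
the number of free integrations in Λ^{(j)c*c}_{10} after enforcing the δ-functions."*; p. 275, first lines: *"We have incorporated some rescaling
factors (powers of L) and the difference between p(e_k) and p(e_{k−1}) into the constant c."*  (5.12.3)–(5.12.4): *"The 4-th and 5-th forms, with
Z_{Λ^{c*c}_{10}}, are a calculation of ∫dA|_{Λ^{c*c}_{10}} δ_{Ax,Λ′_{10}}(A) δ_{Λ′^{c*c}_{10}}(QA) (e_k/2π)^{‖Λ^{c*c}_{10}‖} exp[−½⟨Λ^{c*c}_{10}A,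
∂*σ_{k,loc}∂(Λ^{c*c}_{10} + 2Λ^{c*}_{10})A⟩]. (5.12.3) The factors e_k/2π come from the replacement of du^{(k)} with dA^{(k)} for the free variables;
for the constrained variables the replacement is compensated by a removal of the e_k/2π factor from the δ-functions, see (4.6)–(4.8). We calculate
(5.12.3) by means of a translation A^{(k)} = A^{(k)′} − Λ^{c*c}_{10}Q^{s*}QΛ^{c*}_{10}A^{(k)}, (5.12.4)"*.

THE READING (HOME/GAPS.md G-C2-23; this seat's `BIJ88Eq5127GaugeSector`, hypothesis `HChart`).  The interior gauge variables of the frame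
`BIJ88Eq5128Frame` are the untranslated `U(1)` bond variables `u_b`, `b ∈ Λ^{c*c}_{10}` (`ι`), under `Π_b (b a tree bond ? δ_1 : du_b)`
(`BIJ88InteriorHaarChart.bondLaw Z`, `Z` = the block trees of `δ_{Ax}`); the bracket reads them through the translation `u′ = u·Q^{s*}(Qu)⁻¹` on the
block bonds `c ∈ Λ′^{c*c}_{10}` (`γ`) whose surface bonds `b`, `σ b = c`, are interior (p. 266: *"X^{c*c} includes bonds with one or both endpoints
in X"*).  Print's `dA|_{Λ^{c*c}} δ_{Ax} δ(QA) (e_k/2π)^{‖Λ‖}` is Lebesgue measure on the affine constraint set, parametrized AFTER (5.12.4) by free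
coordinates `x ↦ Ex − Q^{s*}θ` (`θ` = the exterior part `QΛ^{c*}A` of the averages, frozen), with the constant `(e_k/2π)^{‖Λ‖}`, `‖Λ‖` = (4.8).  THE
EXACT STATEMENT relating the two is the CONSTRAINED CHART LAW `chartLaw`: the law of `u′` under `Π_b bondLaw_b`, restricted to the small-field
window `{|(ie_k)⁻¹log u′_b| ≤ r}`, equals `(e_k/2π)^{‖Λ‖}·J ·` (image of Lebesgue measure on the UNWRAPPED box `{x : |(Ex − Q^{s*}θ)_b| ≤ r}` under
`x ↦ (e^{ie_k(Ex − Q^{s*}θ)_b})_b`), `J` the Jacobian of `(x, w) ↦ Ex + Q^{s*}w` (absorbed by print into its constant `c`).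

WHAT IS PROVED (0 `sorry`; no `Prop`-valued fact; standard axioms; Mathlib + this seat's `BIJ88InteriorHaarChart`/`BIJ88Eq5127GaugeSector` only).
 §1 the one-parameter group `e^{ie_kA}` of `U(1)`: `expU1_add/neg/sub/zero`, `expU1_mul_aOf` (`u = e^{ie_kA(u)}`), and **`eq_of_expU1_eq`** —
    injectivity across the CLOSED period `e_ks ∈ (−π, π]` against `|e_kt| < π` (the wrap-around exclusion behind the unwrapped box).
 §2 the surface assignment `σ : ι → Option γ` and the two `Q^{s*}`'s (`sF` at group level, `sA` in the Lie algebra, `sF_expU1` intertwines them),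
    the substitutions `act v : u ↦ u·Q^{s*}v` (`act_act`, `measurable_act`).
 §3 the translated variables `transl q u = u·Q^{s*}(Qu)⁻¹`, `transl_act` (*a substitution is not seen by `u′`*, from the covariance
    `Q(u·Q^{s*}v) = (Qu)·v` — r18's `qU_surfMul` on the torus), the windows `win`, `arc`, `arcR` and their measurability/volume.
 §4 **(4.8) AS LINEAR ALGEBRA**: coordinates `A ↦ (πA, QA)` and parametrization `(x, w) ↦ Ex + Q^{s*}w` of the fields on the non-tree bonds are
    inverse (`freeEquiv`, from the displayed algebra of the δ-constraints), whence **`card_eq_of_freeEquiv`: `#non-tree = ‖Λ‖ + |Λ′^{c*c}|`**, i.e.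
    `‖Λ‖ = |Λ^{c*c}| − #tree − |Λ′^{c*c}|` = (4.8) with `#tree = |Λ′|(L^d − 1)` (r18's `BIJ88FreeCount48.card_treeBonds`); the Jacobian `jac` with
    **`dA = J dx dw`** (`map_volume_freeEquiv`, `lintegral_comp_freeEquiv` — uniqueness of Haar measure, Mathlib's `isAddLeftInvariant_eq_smul`).
 §5 **the bump lemma `lintegral_mul_comp_eq`**: `∫F(u)G(Qu) Π_b bondLaw_b = (∫F)(∫G dv)` for substitution-invariant `F` — `u′` and `Qu` are
    independent, `Qu` Haar distributed (one-bond laws are substitution invariant: `map_act_pi_bondLaw`, surface bonds are not tree bonds).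
 §6 **the support lemma `indicator_eq`** (`forward`/`backward`): on the period cube, [`u′ ∈ window ∧ Qu ∈ bump`] read through `A ↦ e^{ie_kA}` is
    EXACTLY [`x ∈ box ∧ QA + θ ∈ bump`] with `u′ = affChart x` — no wrap-around (`eq_of_expU1_eq`), exact linearization on `|A_b| ≤ r + ε`.
 §7 **`chartLaw`** / **`chartLaw_ofReal`** (the law, with constant `chartConst = (e_k/2π)^{‖Λ‖}·J`, `chartConst_eq`, `piHaar_arc`: the Haar mass of
    the bump is `(e_kε/π)^{|C|}` against its Lebesgue mass `(2ε)^{|C|}` — the `|C|` factors `e_k/2π` *"removed from the δ-functions"*).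
HYPOTHESES OF `chartLaw` (all displayed; discharged on the torus by the successor file from r18's `qU_surfMul`, p31's
`BIJ88Eq536Linearization.qU_phaseField`, r18's `BIJ88FreeCount48` constraint algebra and this seat's `BIJ88InteriorFibration46` geometry):
`e_k > 0`, `r ≥ 0`, `ε > 0`, `e_k(r + ε) < π`; no surface bond is a tree bond; `q` measurable and covariant; EXACT LINEARIZATION
`Q(e^{ie_kA}) = e^{ie_k(Q_linA + θ)}` with `|e_k(Q_linA + θ)| < π` for `|A_b| ≤ r + ε`, `A|_Z = 0`; `QQ^{s*} = 1`, `QE = 0`, `E|_Z = 0`, `πE = 1`,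
`πQ^{s*} = 0`, `A = Eπ(A) + Q^{s*}QA` off the tree; `off = Q^{s*}θ`.
HONEST SCOPE.  Abstract file: the torus objects (`qU`, `surfMul`, the fat interior, `bondAvg`) enter only through the displayed hypotheses; the
Jacobian `J` is Mathlib's `addHaarScalarFactor` (a positive real, not computed: print absorbs it); the Gaussian weight of (4.6)/(5.12.3) is NOT
here (it is p02's `BIJ88ExteriorForms5121`/`BIJ88Measure5127` and this seat's `BIJ88Eq5127GaugeSector`); no bound, no claim about `Z^{(j)}`.
Seat p34 gen 12, file G4 (own lineage; TAKING line HOME/STATUS.md 2026-08-22T07:19Z).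

CITATION HEADER (lean-in-tree rule).  Part of the lit-balaban TYPED SKELETON (HOME `run/shared/lean/pub/lit-balaban/`), PHASE-2 proof seat p34
gen 12 (unit `lit-balaban-p34-g12`).  Rows served: **`C2.Eq5.12.8`** (gauge half of r16's recorded flip condition, G-C2-23 step (iii) *"free-coordinate
parametrization of the δ-constraints (4.8)"*), support `C2.Eq4.8` (owner r18; decl of record `BIJ88Sect4Statements.freeCount`, torus count
`BIJ88FreeCount48.finrank_free48` — here the abstract dimension count of the parametrization) and `C2.Eq5.12.1-5.12.7` ((5.12.3)–(5.12.4)).  Built BY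
NAME on this seat's `BIJ88InteriorHaarChart` (`bondLaw`, `fibreChart`, `extend`, `lintegral_pi_bondLaw_eq_charge`), p31's
`BIJ88Eq537Jacobian.measurePreserving_expU1_charge`, r18's `BIJ85BlockAveragesTorus.expU1`, this seat's `BIJ88Eq5127GaugeSector.aOf`; Mathlib's
Haar uniqueness (`Measure.isAddLeftInvariant_eq_smul`).  PDF held: `paper:balaban1988-cmp114-bij-abelian-higgs-effective-action` (journal page =
PDF page + 256).  [2] = [BalabanImbrieJaffe1985] (`paper:balaban1985-cmp97-bij-higgs-minimizers`), (2.10)–(2.13), (3.9)–(3.12).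
-/


namespace Literature.MathematicalPhysics.QuantumFieldTheory.BalabanImbrieJaffe1984to88.BIJ88FreeCoordinates48

open Literature.MathematicalPhysics.QuantumFieldTheory.Balaban1983to89
open BIJ88Sect3Statements (U1 toC toC_mul toC_one)
open BIJ88Sect3Rescaling (toC_injective_U1)
open BIJ85Sect1Model (argB argB_mem_Ico)
open BIJ85BlockAveragesTorus (expU1 toC_expU1 measurable_expU1 continuous_expU1 exp_argB_toC toC_inv')
open BIJ88Eq537Jacobian (measurePreserving_expU1_charge measurable_expU1_charge)
open BIJ88InteriorHaarChart (chargeMeasure bondLaw bondSource bondChart fibreChart fibreChart_apply extend extend_apply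
  extend_apply_of_not_mem measurableEmbedding_extend lintegral_pi_bondLaw_eq_charge measurable_fibreChart)
open BIJ88Eq5127GaugeSector (aOf measurable_aOf abs_aOf_le aOf_expU1 mul_mem_Ico_of_abs_le)
open scoped BigOperators ENNReal NNReal Matrix Real
open _root_.MeasureTheory _root_.MeasureTheory.Measure Set

noncomputable section

/-! ## §1 The one-parameter group `A ↦ e^{ie_kA}` of `U(1)` and its logarithm -/

section U1Algebra

/-- kernel: `e^{i(a+b)} = e^{ia}e^{ib}`. [cite: BalabanImbrieJaffe1985, (2.12) p.303] -/
theorem expU1_add (a b : ℝ) : expU1 (a + b) = expU1 a * expU1 b := by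
  apply toC_injective_U1
  rw [toC_mul, toC_expU1, toC_expU1, toC_expU1, ← Complex.exp_add]
  push_cast
  ring_nf

/-- kernel: `e^{i0} = 1`. [cite: BalabanImbrieJaffe1985, (2.12) p.303] -/
theorem expU1_zero : expU1 0 = 1 := by
  apply toC_injective_U1
  rw [toC_expU1, toC_one]
  simp

/-- kernel: `e^{−ia} = (e^{ia})⁻¹`. [cite: BalabanImbrieJaffe1985, (2.12) p.303] -/
theorem expU1_neg (a : ℝ) : expU1 (-a) = (expU1 a)⁻¹ := by
  apply toC_injective_U1
  rw [toC_inv', toC_expU1, toC_expU1, ← Complex.exp_neg]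
  push_cast
  ring_nf

/-- kernel: `e^{i(a−b)} = e^{ia}(e^{ib})⁻¹`. [cite: BalabanImbrieJaffe1985, (2.12) p.303] -/
theorem expU1_sub (a b : ℝ) : expU1 (a - b) = expU1 a * (expU1 b)⁻¹ := by
  rw [sub_eq_add_neg, expU1_add, expU1_neg]

/-- **`u = e^{ie_kA(u)}`** — the Lie-algebra coordinate `A = (ie_k)⁻¹ log u` (branch `[−π, π)`) is a genuine logarithm (`e_k ≠ 0`).
[cite: BalabanImbrieJaffe1985, (2.12) p.303] -/
theorem expU1_mul_aOf {ek : ℝ} (hek : ek ≠ 0) (g : U1) : expU1 (ek * aOf ek g) = g := by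
  apply toC_injective_U1
  have h : ek * aOf ek g = argB (toC g) := by unfold aOf; field_simp
  rw [toC_expU1, h, exp_argB_toC]

/-- kernel: `e^{iπ} = e^{−iπ}`. [cite: BalabanImbrieJaffe1985, (2.11) p.303] -/
theorem expU1_pi_eq_expU1_neg_pi : expU1 π = expU1 (-π) := by
  apply toC_injective_U1
  rw [toC_expU1, toC_expU1, show ((-π : ℝ) : ℂ) * Complex.I = (π : ℂ) * Complex.I - 2 * π * Complex.I by push_cast; ring,
    Complex.exp_sub, Complex.exp_two_pi_mul_I, div_one]

/-- **Injectivity of the chart across the closed period**: `e_ks ∈ (−π, π]`, `|e_kt| < π`, `e^{ie_ks} = e^{ie_kt}` ⟹ `s = t` (the endpoint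
`e_ks = π` is excluded because `e^{iπ} = e^{−iπ}` would force `e_kt = −π`). [cite: BalabanImbrieJaffe1985, (2.11) p.303] -/
theorem eq_of_expU1_eq {ek s t : ℝ} (hek : 0 < ek) (hs : ek * s ∈ Set.Ioc (-π) π) (ht : |ek * t| < π)
    (h : expU1 (ek * s) = expU1 (ek * t)) : s = t := by
  have ht' : ek * t ∈ Set.Ico (-π) π := ⟨(abs_lt.mp ht).1.le, (abs_lt.mp ht).2⟩
  have h2 : aOf ek (expU1 (ek * t)) = t := aOf_expU1 hek.ne' ht'
  rcases hs.2.lt_or_eq with hlt | heq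
  · have h1 : aOf ek (expU1 (ek * s)) = s := aOf_expU1 hek.ne' ⟨hs.1.le, hlt⟩
    rw [← h1, h, h2]
  · exfalso
    have hneg : ek * (-π / ek) = -π := by field_simp
    have hπ : expU1 (ek * s) = expU1 (ek * (-π / ek)) := by rw [heq, hneg, expU1_pi_eq_expU1_neg_pi]
    have h3 : aOf ek (expU1 (ek * (-π / ek))) = -π / ek :=
      aOf_expU1 hek.ne' (by rw [hneg]; exact ⟨le_rfl, by linarith [Real.pi_pos]⟩)
    have htv : t = -π / ek := by rw [← h2, ← h, hπ, h3]
    rw [htv, hneg, abs_neg, abs_of_pos Real.pi_pos] at ht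
    exact lt_irrefl _ ht

end U1Algebra

/-! ## §2 The surface assignment `b ↦ c(b)`: the interior part of `Q^{s*}` at group and at Lie-algebra level, and the substitutions `u ↦ u·Q^{s*}v` -/

section Surface

variable {ι : Type*} {γ : Type*} (σ : ι → Option γ)

/-- **`(Q^{s*}v)_b`** at group level: `v_{c(b)}` on a surface bond `b` of the block bond `c(b)`, `1` elsewhere ([2] (3.9)/(4.5.2) read through the
surface assignment `σ : b ↦ c(b)`). [cite: BalabanImbrieJaffe1988, (5.3.1) p.280] -/
def sF (v : γ → U1) (b : ι) : U1 := (σ b).elim 1 v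

/-- **`(Q^{s*}w)_b`** at Lie-algebra level: `w_{c(b)}` on a surface bond, `0` elsewhere (the translation (5.12.4) `Λ^{c*c}Q^{s*}·`).
[cite: BalabanImbrieJaffe1988, (5.12.4) p.301] -/
def sA (w : γ → ℝ) (b : ι) : ℝ := (σ b).elim 0 w

/-- **The substitution `u ↦ u·Q^{s*}v`** on the interior bond variables. [cite: BalabanImbrieJaffe1988, (5.3.1) p.280] -/
def act (v : γ → U1) (u : ι → U1) : ι → U1 := fun b => u b * sF σ v b

variable {σ}

/-- kernel: `(Q^{s*}v)_b = 1` off the surface bonds. [cite: BalabanImbrieJaffe1988, (5.3.1) p.280] -/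
theorem sF_apply_of_eq_none {b : ι} (h : σ b = none) (v : γ → U1) : sF σ v b = 1 := by simp [sF, h]
/-- kernel: `(Q^{s*}v)_b = v_{c(b)}` on a surface bond of `c(b)`. [cite: BalabanImbrieJaffe1988, (5.3.1) p.280] -/
theorem sF_apply_of_eq_some {b : ι} {c : γ} (h : σ b = some c) (v : γ → U1) : sF σ v b = v c := by simp [sF, h]
/-- kernel: `(Q^{s*}w)_b = 0` off the surface bonds. [cite: BalabanImbrieJaffe1988, (5.12.4) p.301] -/
theorem sA_apply_of_eq_none {b : ι} (h : σ b = none) (w : γ → ℝ) : sA σ w b = 0 := by simp [sA, h]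
/-- kernel: `(Q^{s*}w)_b = w_{c(b)}` on a surface bond of `c(b)`. [cite: BalabanImbrieJaffe1988, (5.12.4) p.301] -/
theorem sA_apply_of_eq_some {b : ι} {c : γ} (h : σ b = some c) (w : γ → ℝ) : sA σ w b = w c := by simp [sA, h]

variable (σ)

/-- kernel: `Q^{s*}` is multiplicative. [cite: BalabanImbrieJaffe1988, (5.3.1) p.280] -/
theorem sF_mul (v w : γ → U1) : sF σ (v * w) = sF σ v * sF σ w := by
  funext b; cases h : σ b <;> simp [sF, h]

/-- kernel: `Q^{s*}1 = 1`. [cite: BalabanImbrieJaffe1988, (5.3.1) p.280] -/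
theorem sF_one : sF σ (1 : γ → U1) = 1 := by
  funext b; cases h : σ b <;> simp [sF, h]

/-- kernel: `Q^{s*}(v⁻¹) = (Q^{s*}v)⁻¹`. [cite: BalabanImbrieJaffe1988, (5.3.1) p.280] -/
theorem sF_inv (v : γ → U1) : sF σ v⁻¹ = (sF σ v)⁻¹ := by
  funext b; cases h : σ b <;> simp [sF, h]

/-- kernel: the Lie-algebra `Q^{s*}` is additive. [cite: BalabanImbrieJaffe1988, (5.12.4) p.301] -/
theorem sA_add (w w' : γ → ℝ) : sA σ (w + w') = sA σ w + sA σ w' := by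
  funext b; cases h : σ b <;> simp [sA, h]

/-- kernel: the Lie-algebra `Q^{s*}` is homogeneous. [cite: BalabanImbrieJaffe1988, (5.12.4) p.301] -/
theorem sA_smul (t : ℝ) (w : γ → ℝ) : sA σ (t • w) = t • sA σ w := by
  funext b; cases h : σ b <;> simp [sA, h]

/-- kernel: `Q^{s*}(w − w′) = Q^{s*}w − Q^{s*}w′`. [cite: BalabanImbrieJaffe1988, (5.12.4) p.301] -/
theorem sA_sub (w w' : γ → ℝ) : sA σ (w - w') = sA σ w - sA σ w' := by
  funext b; cases h : σ b <;> simp [sA, h]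

/-- kernel: `|(Q^{s*}w)_b| ≤ ε` when `|w_c| ≤ ε` for all `c` (`ε ≥ 0`). [cite: BalabanImbrieJaffe1988, (5.12.4) p.301] -/
theorem abs_sA_le {w : γ → ℝ} {ε : ℝ} (hε : 0 ≤ ε) (hw : ∀ c, |w c| ≤ ε) (b : ι) : |sA σ w b| ≤ ε := by
  cases h : σ b
  · rw [sA_apply_of_eq_none h]; simpa using hε
  · rw [sA_apply_of_eq_some h]; exact hw _

/-- kernel: strict version — `|(Q^{s*}w)_b| < ε` when `|w_c| < ε` for all `c` (`ε > 0`). [cite: BalabanImbrieJaffe1988, (5.12.4) p.301] -/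
theorem abs_sA_lt {w : γ → ℝ} {ε : ℝ} (hε : 0 < ε) (hw : ∀ c, |w c| < ε) (b : ι) : |sA σ w b| < ε := by
  cases h : σ b
  · rw [sA_apply_of_eq_none h]; simpa using hε
  · rw [sA_apply_of_eq_some h]; exact hw _

/-- **The two `Q^{s*}` are intertwined by the chart**: `Q^{s*}(e^{ie_kw}) = e^{ie_kQ^{s*}w}`. [cite: BalabanImbrieJaffe1988, (5.12.4) p.301] -/
theorem sF_expU1 (ek : ℝ) (w : γ → ℝ) : sF σ (fun c => expU1 (ek * w c)) = fun b => expU1 (ek * sA σ w b) := by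
  funext b
  cases h : σ b
  · rw [sF_apply_of_eq_none h, sA_apply_of_eq_none h, mul_zero, expU1_zero]
  · rw [sF_apply_of_eq_some h, sA_apply_of_eq_some h]

/-- kernel: two substitutions compose, `(u·Q^{s*}w)·Q^{s*}v = u·Q^{s*}(wv)`. [cite: BalabanImbrieJaffe1988, (5.3.1) p.280] -/
theorem act_act (v w : γ → U1) (u : ι → U1) : act σ v (act σ w u) = act σ (w * v) u := by
  funext b; simp only [act, sF_mul, Pi.mul_apply, mul_assoc]

/-- kernel: the trivial substitution. [cite: BalabanImbrieJaffe1988, (5.3.1) p.280] -/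
theorem act_one (u : ι → U1) : act σ 1 u = u := by
  funext b; simp only [act, sF_one, Pi.one_apply, mul_one]

/-- kernel: a substitution is measurable. [cite: BalabanImbrieJaffe1988, (5.3.1) p.280] -/
theorem measurable_act (v : γ → U1) : Measurable (act σ v) :=
  measurable_pi_iff.mpr fun b => (measurable_pi_apply b).mul_const _

/-- the Lie-algebra `Q^{s*}` as a linear map. [cite: BalabanImbrieJaffe1988, (5.12.4) p.301] -/
def sAL : (γ → ℝ) →ₗ[ℝ] (ι → ℝ) where
  toFun := sA σ
  map_add' := sA_add σ
  map_smul' := sA_smul σ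

/-- kernel: the linear map is `Q^{s*}`. [cite: BalabanImbrieJaffe1988, (5.12.4) p.301] -/
@[simp] theorem sAL_apply (w : γ → ℝ) : sAL σ w = sA σ w := rfl

end Surface

/-! ## §3 The translated interior variables `u′ = u·Q^{s*}(Qu)⁻¹` and their windows -/

section Transl

variable {ι : Type*} {γ : Type*} (σ : ι → Option γ) (q : (ι → U1) → (γ → U1)) (ek : ℝ)

/-- **`u′ = u·Q^{s*}(Qu)⁻¹` restricted to the interior** — the translated interior bond variables as a function of the interior ones (block
averages `q`, exterior configuration frozen inside `q`). [cite: BalabanImbrieJaffe1988, (5.3.1) p.280] -/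
def transl (u : ι → U1) : ι → U1 := act σ (q u)⁻¹ u

/-- the small-field window of the translated variables, `|A′_b| ≤ r`. [cite: BalabanImbrieJaffe1988, (5.9.4) p.295] -/
def win (r : ℝ) : Set (ι → U1) := {y | ∀ b, |aOf ek (y b)| ≤ r}

/-- the bump window of the block averages, `|(ie_k)⁻¹ log (Qu)_c| < ε`. [cite: BalabanImbrieJaffe1988, (5.12.3) p.301] -/
def arc (ε : ℝ) : Set (γ → U1) := {w | ∀ c, |aOf ek (w c)| < ε}

/-- the same window in the Lie algebra. [cite: BalabanImbrieJaffe1988, (5.12.3) p.301] -/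
def arcR (ε : ℝ) : Set (γ → ℝ) := {w | ∀ c, |w c| < ε}

variable {σ q}

/-- **`(u·Q^{s*}v)′ = u′`** — the translated variables do not see a substitution, given the covariance `Q(u·Q^{s*}v) = (Qu)·v` of the block
averages (r18's `qU_surfMul`). [cite: BalabanImbrieJaffe1988, (5.3.6) p.280] -/
theorem transl_act (hcov : ∀ u v, q (act σ v u) = q u * v) (u : ι → U1) (v : γ → U1) : transl σ q (act σ v u) = transl σ q u := by
  unfold transl
  rw [hcov, act_act, mul_inv_rev, ← mul_assoc, mul_inv_cancel, one_mul]

/-- kernel: `u = u′·Q^{s*}(Qu)`. [cite: BalabanImbrieJaffe1988, (5.3.1) p.280] -/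
theorem act_transl (u : ι → U1) : act σ (q u) (transl σ q u) = u := by
  unfold transl
  rw [act_act, inv_mul_cancel, act_one]

/-- kernel: `u ↦ u′` is measurable when the block averages are. [cite: BalabanImbrieJaffe1988, (5.3.1) p.280] -/
theorem measurable_transl (hq : Measurable q) : Measurable (transl σ q) := by
  refine measurable_pi_iff.mpr fun b => (measurable_pi_apply b).mul ?_
  cases h : σ b with
  | none => simp only [sF, h, Option.elim]; exact measurable_const
  | some c => simp only [sF, h, Option.elim]; exact ((measurable_pi_apply c).comp hq).inv

variable (q)

/-- kernel: the window of the translated variables is measurable. [cite: BalabanImbrieJaffe1988, (5.9.4) p.295] -/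
theorem measurableSet_win [Fintype ι] (r : ℝ) : MeasurableSet (win (ι := ι) ek r) := by
  have : win (ι := ι) ek r = ⋂ b, {y | |aOf ek (y b)| ≤ r} := by ext y; simp [win]
  rw [this]
  exact MeasurableSet.iInter fun b => measurableSet_le ((measurable_aOf ek).comp (measurable_pi_apply b)).abs measurable_const

/-- kernel: the bump window is measurable. [cite: BalabanImbrieJaffe1988, (5.12.3) p.301] -/
theorem measurableSet_arc [Fintype γ] (ε : ℝ) : MeasurableSet (arc (γ := γ) ek ε) := by
  have : arc (γ := γ) ek ε = ⋂ c, {w | |aOf ek (w c)| < ε} := by ext w; simp [arc]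
  rw [this]
  exact MeasurableSet.iInter fun c => measurableSet_lt ((measurable_aOf ek).comp (measurable_pi_apply c)).abs measurable_const

/-- kernel: the Lie-algebra bump window is the open sup-norm box, measurable with Lebesgue measure `(2ε)^{|C|}`.
[cite: BalabanImbrieJaffe1988, (5.12.3) p.301] -/
theorem arcR_eq_pi (ε : ℝ) : arcR (γ := γ) ε = Set.pi Set.univ fun _ => Set.Ioo (-ε) ε := by
  ext w; simp [arcR, abs_lt]

/-- kernel: the Lie-algebra bump window is measurable. [cite: BalabanImbrieJaffe1988, (5.12.3) p.301] -/
theorem measurableSet_arcR [Fintype γ] (ε : ℝ) : MeasurableSet (arcR (γ := γ) ε) := by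
  rw [arcR_eq_pi]; exact MeasurableSet.univ_pi fun _ => measurableSet_Ioo

/-- kernel: the Lie-algebra bump window has Lebesgue measure `(2ε)^{|C|}`. [cite: BalabanImbrieJaffe1988, (5.12.3) p.301] -/
theorem volume_arcR [Fintype γ] (ε : ℝ) : volume (arcR (γ := γ) ε) = ENNReal.ofReal (2 * ε) ^ Fintype.card γ := by
  rw [arcR_eq_pi, volume_pi_pi]
  simp only [Real.volume_Ioo, Finset.prod_const, Finset.card_univ]
  congr 2; ring

end Transl

/-! ## §4 The free coordinates (4.8): `A = Ex + Q^{s*}w` on the non-tree bonds, the Jacobian, and the count `#non-tree = ‖Λ‖ + |C|` -/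

section Free

variable {ι : Type*} (Z : Set ι) [DecidablePred (· ∈ Z)] {γ : Type*} (σ : ι → Option γ) {φ : Type*}
variable (Qm : (ι → ℝ) →ₗ[ℝ] (γ → ℝ)) (πf : (ι → ℝ) →ₗ[ℝ] (φ → ℝ))

/-- restriction of a Lie-algebra field to the non-tree bonds. [cite: BalabanImbrieJaffe1988, (4.8) p.275] -/
def restr (A : ι → ℝ) : {b : ι // b ∉ Z} → ℝ := fun b => A b.1

/-- kernel: extension by zero then restriction is the identity. [cite: BalabanImbrieJaffe1988, (4.8) p.275] -/
theorem restr_extend (x : {b : ι // b ∉ Z} → ℝ) : restr Z (extend Z x) = x := by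
  funext b; exact extend_apply_of_not_mem Z x b

/-- kernel: a field vanishing on the tree bonds is the extension of its restriction. [cite: BalabanImbrieJaffe1988, (4.8) p.275] -/
theorem extend_restr {A : ι → ℝ} (hA : ∀ b ∈ Z, A b = 0) : extend Z (restr Z A) = A := by
  funext b
  rw [extend_apply]
  split_ifs with h
  · exact (hA b h).symm
  · rfl

/-- kernel: the extension vanishes on the tree bonds. [cite: BalabanImbrieJaffe1988, (4.8) p.275] -/
theorem extend_apply_of_mem (x : {b : ι // b ∉ Z} → ℝ) {b : ι} (hb : b ∈ Z) : extend Z x b = 0 := by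
  rw [extend_apply, dif_pos hb]

/-- extension by zero as a linear map. [cite: BalabanImbrieJaffe1988, (4.8) p.275] -/
def extendL : ({b : ι // b ∉ Z} → ℝ) →ₗ[ℝ] (ι → ℝ) where
  toFun := extend Z
  map_add' x y := by
    funext b; simp only [extend_apply, Pi.add_apply]; split_ifs <;> simp
  map_smul' t x := by
    funext b; simp only [extend_apply, Pi.smul_apply, smul_eq_mul, RingHom.id_apply]; split_ifs <;> simp

/-- kernel: the linear map is the extension by zero. [cite: BalabanImbrieJaffe1988, (4.8) p.275] -/
@[simp] theorem extendL_apply (x : {b : ι // b ∉ Z} → ℝ) : extendL Z x = extend Z x := rfl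

/-- **THE COORDINATES `A ↦ (x, w) = (free coordinates of A, QA)`** of a field on the non-tree interior bonds. [cite: BalabanImbrieJaffe1988, (4.8) p.275] -/
def coords : ({b : ι // b ∉ Z} → ℝ) →ₗ[ℝ] (φ → ℝ) × (γ → ℝ) :=
  (πf ∘ₗ extendL Z).prod (Qm ∘ₗ extendL Z)

/-- kernel: the coordinates of a field. [cite: BalabanImbrieJaffe1988, (4.8) p.275] -/
@[simp] theorem coords_apply (x : {b : ι // b ∉ Z} → ℝ) : coords Z Qm πf x = (πf (extend Z x), Qm (extend Z x)) := rfl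

/-- restriction to the non-tree bonds as a linear map. [cite: BalabanImbrieJaffe1988, (4.8) p.275] -/
def restrL : (ι → ℝ) →ₗ[ℝ] ({b : ι // b ∉ Z} → ℝ) where
  toFun := restr Z
  map_add' _ _ := rfl
  map_smul' _ _ := rfl

omit [DecidablePred (· ∈ Z)] in
/-- kernel: the linear map is the restriction. [cite: BalabanImbrieJaffe1988, (4.8) p.275] -/
@[simp] theorem restrL_apply (A : ι → ℝ) : restrL Z A = restr Z A := rfl

variable [Fintype φ] (E : Matrix ι φ ℝ)

/-- **THE PARAMETRIZATION `(x, w) ↦ A = Ex + Q^{s*}w`** of the fields on the non-tree interior bonds by free coordinates `x` and block averages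
`w` — *"the number of free integrations … after enforcing the δ-functions"* made a map. [cite: BalabanImbrieJaffe1988, (4.8) p.275] -/
def param : (φ → ℝ) × (γ → ℝ) →ₗ[ℝ] ({b : ι // b ∉ Z} → ℝ) :=
  restrL Z ∘ₗ ((Matrix.mulVecLin E).coprod (sAL σ))

omit [DecidablePred (· ∈ Z)] in
/-- kernel: the parametrization of a pair `(x, w)`. [cite: BalabanImbrieJaffe1988, (4.8) p.275] -/
@[simp] theorem param_apply (p : (φ → ℝ) × (γ → ℝ)) : param Z σ E p = restr Z (E *ᵥ p.1 + sA σ p.2) := rfl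

variable {Z σ E Qm πf}

/-- **THE FREE-COORDINATE EQUIVALENCE** `A ↔ (x, w)`: under the algebra of the δ-constraints — `QQ^{s*} = 1`, `QE = 0`, `E` and `Q^{s*}` vanish
on the tree bonds, the free-coordinate reading `π` inverts `E` and kills `Q^{s*}`, and every field vanishing on the tree is `Eπ(A) + Q^{s*}QA` —
the coordinates and the parametrization are mutually inverse linear maps. [cite: BalabanImbrieJaffe1988, (4.8) p.275] -/
def freeEquiv (hσZ : ∀ b ∈ Z, σ b = none) (hQS : ∀ w, Qm (sA σ w) = w) (hQE : ∀ x, Qm (E *ᵥ x) = 0)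
    (hEZ : ∀ x, ∀ b ∈ Z, (E *ᵥ x) b = 0) (hπE : ∀ x, πf (E *ᵥ x) = x) (hπS : ∀ w, πf (sA σ w) = 0)
    (hrec : ∀ A : ι → ℝ, (∀ b ∈ Z, A b = 0) → E *ᵥ πf A + sA σ (Qm A) = A) :
    ({b : ι // b ∉ Z} → ℝ) ≃ₗ[ℝ] (φ → ℝ) × (γ → ℝ) :=
  LinearEquiv.ofLinear (coords Z Qm πf) (param Z σ E)
    (by
      apply LinearMap.ext
      intro p
      have hz : ∀ b ∈ Z, (E *ᵥ p.1 + sA σ p.2) b = 0 := fun b hb => by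
        rw [Pi.add_apply, hEZ p.1 b hb, sA_apply_of_eq_none (hσZ b hb), add_zero]
      simp only [LinearMap.comp_apply, coords_apply, param_apply, extend_restr Z hz, map_add, hπE, hπS, hQE, hQS, add_zero, zero_add,
        LinearMap.id_apply])
    (by
      apply LinearMap.ext
      intro x
      have hz : ∀ b ∈ Z, extend Z x b = 0 := fun b hb => extend_apply_of_mem Z x hb
      simp only [LinearMap.comp_apply, coords_apply, param_apply, hrec _ hz, restr_extend, LinearMap.id_apply])

/-- kernel: the coordinates of the equivalence. [cite: BalabanImbrieJaffe1988, (4.8) p.275] -/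
theorem freeEquiv_apply (hσZ : ∀ b ∈ Z, σ b = none) (hQS : ∀ w, Qm (sA σ w) = w) (hQE : ∀ x, Qm (E *ᵥ x) = 0)
    (hEZ : ∀ x, ∀ b ∈ Z, (E *ᵥ x) b = 0) (hπE : ∀ x, πf (E *ᵥ x) = x) (hπS : ∀ w, πf (sA σ w) = 0)
    (hrec : ∀ A : ι → ℝ, (∀ b ∈ Z, A b = 0) → E *ᵥ πf A + sA σ (Qm A) = A) (x : {b : ι // b ∉ Z} → ℝ) :
    freeEquiv hσZ hQS hQE hEZ hπE hπS hrec x = (πf (extend Z x), Qm (extend Z x)) := rfl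

variable [Fintype ι] [Fintype γ]

/-- **(4.8) — THE NUMBER OF FREE INTEGRATIONS**: `#(non-tree interior bonds) = ‖Λ‖ + |C|`, i.e. `‖Λ‖ = |Λ^{c*c}| − |tree bonds| − |Λ′^{c*c}|`
(*"‖Λ^{(j)c*c}_{10}‖ is the number of free integrations in Λ^{(j)c*c}_{10} after enforcing the δ-functions"*; on the torus r18's
`BIJ88FreeCount48.finrank_free48_add`), here as the dimension count of the free-coordinate equivalence. [cite: BalabanImbrieJaffe1988, (4.8) p.275] -/
theorem card_eq_of_freeEquiv (e : ({b : ι // b ∉ Z} → ℝ) ≃ₗ[ℝ] (φ → ℝ) × (γ → ℝ)) :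
    Fintype.card {b : ι // b ∉ Z} = Fintype.card φ + Fintype.card γ := by
  have h := e.finrank_eq
  rw [Module.finrank_prod, Module.finrank_fintype_fun_eq_card, Module.finrank_fintype_fun_eq_card,
    Module.finrank_fintype_fun_eq_card] at h
  exact h

/-- **THE JACOBIAN** of the free-coordinate parametrization: the constant `J` with `dA|_{non-tree} = J·dx dw` (Lebesgue measure on the non-tree
coordinates pushed to `(x, w)` is `J` times Lebesgue measure — uniqueness of Haar measure; print absorbs `J` into its constant: *"We have
incorporated some rescaling factors (powers of L) … into the constant"*, p. 275). [cite: BalabanImbrieJaffe1988, (4.8) p.275] -/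
def jac (e : ({b : ι // b ∉ Z} → ℝ) ≃ₗ[ℝ] (φ → ℝ) × (γ → ℝ)) : ℝ≥0 :=
  haveI := prod.instIsAddHaarMeasure (volume : Measure (φ → ℝ)) (volume : Measure (γ → ℝ))
  haveI : IsAddHaarMeasure ((volume : Measure ({b : ι // b ∉ Z} → ℝ)).map e) := e.toContinuousLinearEquiv.isAddHaarMeasure_map volume
  ((volume : Measure ({b : ι // b ∉ Z} → ℝ)).map e).addHaarScalarFactor ((volume : Measure (φ → ℝ)).prod (volume : Measure (γ → ℝ)))

/-- **`dA = J·dx dw`**: the image of Lebesgue measure under the coordinates is `J ·` Lebesgue measure. [cite: BalabanImbrieJaffe1988, (4.8) p.275] -/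
theorem map_volume_freeEquiv (e : ({b : ι // b ∉ Z} → ℝ) ≃ₗ[ℝ] (φ → ℝ) × (γ → ℝ)) :
    (volume : Measure ({b : ι // b ∉ Z} → ℝ)).map e = (jac e : ℝ≥0∞) • ((volume : Measure (φ → ℝ)).prod (volume : Measure (γ → ℝ))) := by
  haveI := prod.instIsAddHaarMeasure (volume : Measure (φ → ℝ)) (volume : Measure (γ → ℝ))
  haveI : IsAddHaarMeasure ((volume : Measure ({b : ι // b ∉ Z} → ℝ)).map e) :=
    e.toContinuousLinearEquiv.isAddHaarMeasure_map volume
  have h := isAddLeftInvariant_eq_smul ((volume : Measure ({b : ι // b ∉ Z} → ℝ)).map e)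
    ((volume : Measure (φ → ℝ)).prod (volume : Measure (γ → ℝ)))
  rw [h]
  ext s hs
  rw [Measure.coe_nnreal_smul_apply, Measure.smul_apply, smul_eq_mul]
  rfl

/-- kernel: the Jacobian is positive. [cite: BalabanImbrieJaffe1988, (4.8) p.275] -/
theorem jac_pos (e : ({b : ι // b ∉ Z} → ℝ) ≃ₗ[ℝ] (φ → ℝ) × (γ → ℝ)) : 0 < jac e := by
  haveI := prod.instIsAddHaarMeasure (volume : Measure (φ → ℝ)) (volume : Measure (γ → ℝ))
  haveI : IsAddHaarMeasure ((volume : Measure ({b : ι // b ∉ Z} → ℝ)).map e) :=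
    e.toContinuousLinearEquiv.isAddHaarMeasure_map volume
  unfold jac
  exact addHaarScalarFactor_pos_of_isAddHaarMeasure ((volume : Measure ({b : ι // b ∉ Z} → ℝ)).map e)
    ((volume : Measure (φ → ℝ)).prod (volume : Measure (γ → ℝ)))

/-- **THE CHANGE OF VARIABLES `∫ g(x(A), w(A)) dA = J ∫∫ g(x, w) dx dw`** (`ℝ≥0∞`-valued, `g` measurable).
[cite: BalabanImbrieJaffe1988, (4.8) p.275] -/
theorem lintegral_comp_freeEquiv (e : ({b : ι // b ∉ Z} → ℝ) ≃ₗ[ℝ] (φ → ℝ) × (γ → ℝ)) {g : (φ → ℝ) × (γ → ℝ) → ℝ≥0∞}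
    (hg : Measurable g) : ∫⁻ A, g (e A) = jac e * ∫⁻ x, ∫⁻ w, g (x, w) := by
  have hme : Measurable e := e.toContinuousLinearEquiv.continuous.measurable
  rw [← lintegral_map hg hme, map_volume_freeEquiv, lintegral_smul_measure, lintegral_prod _ hg.aemeasurable, smul_eq_mul]

end Free

/-! ## §5 The bump lemma: the translated variables are independent of the block averages -/

section Bump

variable {ι : Type*} [Fintype ι] (Z : Set ι) [DecidablePred (· ∈ Z)] {γ : Type*} (σ : ι → Option γ) {q : (ι → U1) → (γ → U1)}

/-- **The one-bond laws `Π_b (δ_{Ax}? δ_1 : du_b)` are invariant under every substitution `u ↦ u·Q^{s*}v`** (surface bonds are not tree bonds;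
Haar measure is translation invariant). [cite: BalabanImbrieJaffe1988, (5.3.1) p.280] -/
theorem map_act_pi_bondLaw (hσZ : ∀ b ∈ Z, σ b = none) (v : γ → U1) :
    (Measure.pi (bondLaw Z)).map (act σ v) = Measure.pi (bondLaw Z) := by
  refine (measurePreserving_pi (bondLaw Z) (bondLaw Z) (f := fun b g => g * sF σ v b) fun b => ?_).map_eq
  by_cases hb : b ∈ Z
  · have h1 : (fun g : U1 => g * sF σ v b) = id := by funext g; rw [sF_apply_of_eq_none (hσZ b hb), mul_one]; rfl
    rw [h1]; exact MeasurePreserving.id _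
  · unfold bondLaw
    simp only [if_neg hb]
    exact ⟨measurable_mul_const _, HaarData.map_mul_right _⟩

variable [Fintype γ]

/-- kernel: left translations preserve the product Haar measure of the block-average group `U(1)^C`. [cite: BalabanImbrieJaffe1988, (5.12.7) p.302] -/
theorem measurePreserving_mul_left_piHaar (v : γ → U1) :
    MeasurePreserving (fun w : γ → U1 => v * w) (Measure.pi fun _ : γ => (HaarData.haar : Measure U1))
      (Measure.pi fun _ : γ => (HaarData.haar : Measure U1)) :=
  measurePreserving_pi _ _ (f := fun c g => v c * g) fun _ => ⟨measurable_const_mul _, HaarData.map_mul_left _⟩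

/-- **THE BUMP LEMMA / INDEPENDENCE IN PRODUCT FORM.**  If the block averages are covariant, `Q(u·Q^{s*}v) = (Qu)·v`, then for every
substitution-invariant `F ≥ 0` and every `G ≥ 0` on the block-average group: `∫ F(u)·G(Qu) Π_b du_b = (∫ F Π_b du_b)·(∫ G dv)` (`dv` = Haar
probability of `U(1)^C`) — in particular with `F = F′(u′)` a function of the translated variables: `u′` and `Qu` are independent, `Qu` Haar
distributed (the group-level content of *"δ(QA″)"* in (5.12.7); torus form: this seat's `BIJ88InteriorFibration46`). [cite: BalabanImbrieJaffe1988, (5.12.7) p.302] -/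
theorem lintegral_mul_comp_eq (hσZ : ∀ b ∈ Z, σ b = none) (hq : Measurable q) (hcov : ∀ u v, q (act σ v u) = q u * v)
    {F : (ι → U1) → ℝ≥0∞} (hF : Measurable F) (hFinv : ∀ u v, F (act σ v u) = F u) {G : (γ → U1) → ℝ≥0∞} (hG : Measurable G) :
    ∫⁻ u, F u * G (q u) ∂Measure.pi (bondLaw Z) =
      (∫⁻ u, F u ∂Measure.pi (bondLaw Z)) * ∫⁻ w, G w ∂Measure.pi fun _ : γ => (HaarData.haar : Measure U1) := by
  set μ := Measure.pi (bondLaw Z) with hμ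
  set W := Measure.pi fun _ : γ => (HaarData.haar : Measure U1) with hW
  -- each substitution leaves the left side unchanged, with `G` translated
  have h1 : ∀ v, ∫⁻ u, F u * G (q u * v) ∂μ = ∫⁻ u, F u * G (q u) ∂μ := fun v => by
    have hmp : MeasurePreserving (act σ v) μ μ := ⟨measurable_act σ v, map_act_pi_bondLaw Z σ hσZ v⟩
    calc ∫⁻ u, F u * G (q u * v) ∂μ = ∫⁻ u, F (act σ v u) * G (q (act σ v u)) ∂μ := by simp_rw [hFinv, hcov]
      _ = ∫⁻ u, F u * G (q u) ∂μ := hmp.lintegral_comp (hF.mul (hG.comp hq))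
  -- average over `v` against the Haar probability of the block-average group
  have h2 : ∀ u, ∫⁻ v, G (q u * v) ∂W = ∫⁻ w, G w ∂W := fun u =>
    (measurePreserving_mul_left_piHaar (q u)).lintegral_comp hG
  have hm2 : Measurable fun p : (ι → U1) × (γ → U1) => F p.1 * G (q p.1 * p.2) :=
    (hF.comp measurable_fst).mul (hG.comp (((hq.comp measurable_fst)).mul measurable_snd))
  calc ∫⁻ u, F u * G (q u) ∂μ = ∫⁻ v, ∫⁻ u, F u * G (q u) ∂μ ∂W := by rw [lintegral_const, measure_univ, mul_one]
    _ = ∫⁻ v, ∫⁻ u, F u * G (q u * v) ∂μ ∂W := by simp_rw [h1]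
    _ = ∫⁻ u, ∫⁻ v, F u * G (q u * v) ∂W ∂μ := lintegral_lintegral_swap hm2.aemeasurable |>.symm
    _ = ∫⁻ u, F u * ∫⁻ v, G (q u * v) ∂W ∂μ := by
        refine lintegral_congr fun u => ?_
        rw [lintegral_const_mul _ (show Measurable (fun v => G (q u * v)) from hG.comp (measurable_const_mul _))]
    _ = ∫⁻ u, F u * ∫⁻ w, G w ∂W ∂μ := by simp_rw [h2]
    _ = (∫⁻ u, F u ∂μ) * ∫⁻ w, G w ∂W := lintegral_mul_const _ hF

end Bump

/-! ## §6 The support lemma: on the window, the chart, the translation and the free coordinates match exactly -/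

section Support

variable {ι : Type*} (Z : Set ι) [DecidablePred (· ∈ Z)] {γ : Type*} (σ : ι → Option γ)
variable (q : (ι → U1) → (γ → U1)) (ek r ε : ℝ)
variable {φ : Type*} [Fintype φ] (E : Matrix ι φ ℝ) (off : ι → ℝ) (Qm : (ι → ℝ) →ₗ[ℝ] (γ → ℝ)) (θ : γ → ℝ)
variable (πf : (ι → ℝ) →ₗ[ℝ] (φ → ℝ))

/-- **THE UNWRAPPED BOX** of the free coordinates: `{x : |(Ex − off)_b| ≤ r for all interior bonds b}` (`off = Q^{s*}θ` the exterior
translation (5.12.4)). [cite: BalabanImbrieJaffe1988, (5.12.4) p.301] -/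
def box : Set (φ → ℝ) := {x | ∀ b, |(E *ᵥ x - off) b| ≤ r}

/-- **THE AFFINE CHART** `x ↦ (e^{ie_k(Ex − off)_b})_b` of the constraint set. [cite: BalabanImbrieJaffe1988, (5.12.4) p.301] -/
def affChart (x : φ → ℝ) : ι → U1 := fun b => expU1 (ek * (E *ᵥ x - off) b)

/-- the period cube of the non-tree Lie-algebra coordinates, `A_b ∈ (−π/e_k, π/e_k]`. [cite: BalabanImbrieJaffe1988, (5.12.3) p.301] -/
def cube : Set ({b : ι // b ∉ Z} → ℝ) := Set.pi Set.univ fun _ => Set.Ioc (-π / ek) (π / ek)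

variable {Z σ q ek r ε E off Qm θ πf}

/-- kernel: the fibre chart of a field extended by zero is the plain phase field `(e^{ie_kA_b})_b`. [cite: BalabanImbrieJaffe1988, (5.12.3) p.301] -/
theorem fibreChart_extend (A' : {b : ι // b ∉ Z} → ℝ) : fibreChart Z ek (extend Z A') = fun b => expU1 (ek * extend Z A' b) := by
  funext b
  rw [fibreChart_apply]
  split_ifs with hb
  · rw [extend_apply_of_mem Z A' hb, mul_zero, expU1_zero]
  · rfl

/-- kernel: a point of the box is charted into the window (`e_k r < π`). [cite: BalabanImbrieJaffe1988, (5.9.4) p.295] -/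
theorem affChart_mem_win (hek : 0 < ek) (hrπ : ek * r < π) {x : φ → ℝ} (hx : x ∈ box r E off) : affChart ek E off x ∈ win ek r := by
  intro b
  show |aOf ek (expU1 (ek * (E *ᵥ x - off) b))| ≤ r
  rw [aOf_expU1 hek.ne' (mul_mem_Ico_of_abs_le hek hrπ (hx b))]
  exact hx b

/-- **FORWARD**: if the free coordinates of `A` (vanishing on the tree) lie in the box and `QA + θ` in the bump window, then `A` is in the period
cube, the block averages of `u = e^{ie_kA}` ARE `e^{ie_k(QA+θ)}` (linearization), and the translated variables ARE the affine chart of the free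
coordinates: `u′ = (e^{ie_k(Ex − Q^{s*}θ)_b})_b`. [cite: BalabanImbrieJaffe1988, (5.12.4) p.301] -/
theorem forward (hek : 0 < ek) (hε : 0 < ε) (hsmall : ek * (r + ε) < π) (hoff : ∀ b, off b = sA σ θ b)
    (hlin : ∀ A : ι → ℝ, (∀ b, |A b| ≤ r + ε) → (∀ b ∈ Z, A b = 0) →
      q (fun b => expU1 (ek * A b)) = fun c => expU1 (ek * (Qm A c + θ c)))
    (hrec : ∀ A : ι → ℝ, (∀ b ∈ Z, A b = 0) → E *ᵥ πf A + sA σ (Qm A) = A)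
    (A' : {b : ι // b ∉ Z} → ℝ) (hx : πf (extend Z A') ∈ box r E off) (hw : Qm (extend Z A') + θ ∈ arcR ε) :
    A' ∈ cube Z ek ∧
      q (fun b => expU1 (ek * extend Z A' b)) = (fun c => expU1 (ek * (Qm (extend Z A') + θ) c)) ∧
      transl σ q (fun b => expU1 (ek * extend Z A' b)) = affChart ek E off (πf (extend Z A')) := by
  set A := extend Z A' with hA
  have hAZ : ∀ b ∈ Z, A b = 0 := fun b hb => extend_apply_of_mem Z A' hb
  have hdec : ∀ b, A b = (E *ᵥ πf A - off) b + sA σ (Qm A + θ) b := by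
    intro b
    have h := congrFun (hrec A hAZ) b
    simp only [Pi.add_apply, Pi.sub_apply, sA_add, hoff] at h ⊢
    linarith
  have hbound : ∀ b, |A b| ≤ r + ε := by
    intro b
    rw [hdec b]
    have h1 : |(E *ᵥ πf A - off) b| ≤ r := hx b
    have h2 : |sA σ (Qm A + θ) b| < ε := abs_sA_lt σ hε hw b
    exact (abs_add_le _ _).trans (by linarith)
  have hql : q (fun b => expU1 (ek * A b)) = fun c => expU1 (ek * (Qm A c + θ c)) := hlin A hbound hAZ
  refine ⟨?_, hql, ?_⟩
  · intro b _
    have hb := hbound b.1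
    rw [show A b.1 = A' b from extend_apply_of_not_mem Z A' b, abs_le] at hb
    have hlt : r + ε < π / ek := by rw [lt_div_iff₀ hek]; nlinarith
    rw [Set.mem_Ioc, neg_div]
    exact ⟨by linarith, by linarith⟩
  · funext b
    show expU1 (ek * A b) * sF σ (q (fun b => expU1 (ek * A b)))⁻¹ b = expU1 (ek * (E *ᵥ πf A - off) b)
    rw [hql, sF_inv, Pi.inv_apply, sF_expU1, ← expU1_sub, ← mul_sub]
    have h5 : A b - sA σ (Qm A + θ) b = (E *ᵥ πf A - off) b := by linarith [hdec b]
    exact congrArg (fun t => expU1 (ek * t)) h5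

/-- **BACKWARD**: if `A` is in the period cube, its translated variables `u′` in the window and its block averages in the bump window, then the
free coordinates of `A` lie in the box and `QA + θ` in the bump window — no wrap-around: the chart is injective across the closed period
(`eq_of_expU1_eq`) and the linearization is exact on `|A_b| ≤ r + ε`. [cite: BalabanImbrieJaffe1988, (5.12.4) p.301] -/
theorem backward (hek : 0 < ek) (hε : 0 < ε) (hr : 0 ≤ r) (hsmall : ek * (r + ε) < π) (hoff : ∀ b, off b = sA σ θ b)
    (hlin : ∀ A : ι → ℝ, (∀ b, |A b| ≤ r + ε) → (∀ b ∈ Z, A b = 0) →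
      q (fun b => expU1 (ek * A b)) = fun c => expU1 (ek * (Qm A c + θ c)))
    (hbd : ∀ A : ι → ℝ, (∀ b, |A b| ≤ r + ε) → (∀ b ∈ Z, A b = 0) → ∀ c, |ek * (Qm A c + θ c)| < π)
    (hrec : ∀ A : ι → ℝ, (∀ b ∈ Z, A b = 0) → E *ᵥ πf A + sA σ (Qm A) = A)
    (A' : {b : ι // b ∉ Z} → ℝ) (hcube : A' ∈ cube Z ek) (hwin : transl σ q (fun b => expU1 (ek * extend Z A' b)) ∈ win ek r)
    (harc : q (fun b => expU1 (ek * extend Z A' b)) ∈ arc ek ε) :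
    πf (extend Z A') ∈ box r E off ∧ Qm (extend Z A') + θ ∈ arcR ε := by
  set A := extend Z A' with hA
  have hAZ : ∀ b ∈ Z, A b = 0 := fun b hb => extend_apply_of_mem Z A' hb
  set u : ι → U1 := fun b => expU1 (ek * A b) with hu
  -- Lie-algebra coordinates of the block averages and of the translated variables
  set ω : γ → ℝ := fun c => aOf ek (q u c) with hω
  set yy : ι → ℝ := fun b => aOf ek (transl σ q u b) with hyy
  have hωlt : ∀ c, |ω c| < ε := harc
  have hyle : ∀ b, |yy b| ≤ r := hwin
  have hvexp : q u = fun c => expU1 (ek * ω c) := funext fun c => (expU1_mul_aOf hek.ne' (q u c)).symm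
  have hyexp : ∀ b, transl σ q u b = expU1 (ek * yy b) := fun b => (expU1_mul_aOf hek.ne' _).symm
  have hsum : ∀ b, |yy b + sA σ ω b| < r + ε := fun b =>
    lt_of_le_of_lt (abs_add_le _ _) (by linarith [hyle b, abs_sA_lt σ hε hωlt b])
  -- `u = u′·Q^{s*}(Qu)` read in coordinates: `A_b = y_b + (Q^{s*}ω)_b`
  have hu_eq : ∀ b, u b = expU1 (ek * (yy b + sA σ ω b)) := by
    intro b
    have h := congrFun (act_transl (σ := σ) (q := q) u) b
    rw [← h]
    show transl σ q u b * sF σ (q u) b = _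
    rw [hyexp b, hvexp, sF_expU1, mul_add, expU1_add]
  have hAeq : ∀ b, A b = yy b + sA σ ω b := by
    intro b
    refine eq_of_expU1_eq hek ?_ ?_ (hu_eq b)
    · by_cases hb : b ∈ Z
      · rw [hAZ b hb, mul_zero]; exact ⟨by linarith [Real.pi_pos], Real.pi_pos.le⟩
      · have h := hcube ⟨b, hb⟩ (Set.mem_univ _)
        rw [show A' ⟨b, hb⟩ = A b from (extend_apply_of_not_mem Z A' ⟨b, hb⟩).symm] at h
        constructor
        · have := mul_lt_mul_of_pos_left h.1 hek
          rwa [show ek * (-π / ek) = -π by field_simp] at this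
        · have := mul_le_mul_of_nonneg_left h.2 hek.le
          rwa [show ek * (π / ek) = π by field_simp] at this
    · rw [abs_mul, abs_of_pos hek]
      calc ek * |yy b + sA σ ω b| ≤ ek * (r + ε) := mul_le_mul_of_nonneg_left (hsum b).le hek.le
        _ < π := hsmall
  have hbound : ∀ b, |A b| ≤ r + ε := fun b => by rw [hAeq b]; exact (hsum b).le
  -- the linearization is exact here, so `ω = QA + θ`
  have hql : q u = fun c => expU1 (ek * (Qm A c + θ c)) := hlin A hbound hAZ
  have hωeq : ∀ c, ω c = Qm A c + θ c := by
    intro c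
    refine eq_of_expU1_eq hek ?_ (hbd A hbound hAZ c) ?_
    · have h1 : |ek * ω c| < π := by
        rw [abs_mul, abs_of_pos hek]
        calc ek * |ω c| ≤ ek * (r + ε) := mul_le_mul_of_nonneg_left (by linarith [hωlt c]) hek.le
          _ < π := hsmall
      exact ⟨(abs_lt.mp h1).1, (abs_lt.mp h1).2.le⟩
    · have h1 := congrFun hvexp c
      have h2 := congrFun hql c
      rw [← h1, ← h2]
  refine ⟨fun b => ?_, fun c => ?_⟩
  · have h := congrFun (hrec A hAZ) b
    have hωfun : sA σ ω b = sA σ (Qm A) b + sA σ θ b := by rw [show ω = Qm A + θ from funext hωeq, sA_add]; rfl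
    have : (E *ᵥ πf A - off) b = yy b := by
      simp only [Pi.add_apply, Pi.sub_apply, hoff] at h ⊢
      linarith [hAeq b]
    rw [this]
    exact hyle b
  · show |(Qm A + θ) c| < ε
    rw [Pi.add_apply, ← hωeq c]
    exact hωlt c

/-- **THE SUPPORT LEMMA (pointwise form of the measure identity).**  On the period cube, the windowed indicator of the translated variables
times the bump indicator of the block averages, read through the chart `A ↦ e^{ie_kA}`, IS the box indicator of the free coordinates times the
bump indicator of `QA + θ`. [cite: BalabanImbrieJaffe1988, (5.12.4) p.301] -/
theorem indicator_eq (hek : 0 < ek) (hε : 0 < ε) (hsmall : ek * (r + ε) < π) (hr : 0 ≤ r) (hoff : ∀ b, off b = sA σ θ b)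
    (hlin : ∀ A : ι → ℝ, (∀ b, |A b| ≤ r + ε) → (∀ b ∈ Z, A b = 0) →
      q (fun b => expU1 (ek * A b)) = fun c => expU1 (ek * (Qm A c + θ c)))
    (hbd : ∀ A : ι → ℝ, (∀ b, |A b| ≤ r + ε) → (∀ b ∈ Z, A b = 0) → ∀ c, |ek * (Qm A c + θ c)| < π)
    (hrec : ∀ A : ι → ℝ, (∀ b ∈ Z, A b = 0) → E *ᵥ πf A + sA σ (Qm A) = A)
    (S : Set (ι → U1)) (A' : {b : ι // b ∉ Z} → ℝ) :
    (cube Z ek).indicator (fun A' => (S ∩ win ek r).indicator (1 : (ι → U1) → ℝ≥0∞) (transl σ q (fun b => expU1 (ek * extend Z A' b))) *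
        (arc ek ε).indicator (1 : (γ → U1) → ℝ≥0∞) (q (fun b => expU1 (ek * extend Z A' b)))) A' =
      (affChart ek E off ⁻¹' S ∩ box r E off).indicator (1 : (φ → ℝ) → ℝ≥0∞) (πf (extend Z A')) *
        (arcR ε).indicator (1 : (γ → ℝ) → ℝ≥0∞) (Qm (extend Z A') + θ) := by
  have hrπ : ek * r < π := by nlinarith
  by_cases h : πf (extend Z A') ∈ box r E off ∧ Qm (extend Z A') + θ ∈ arcR ε
  · obtain ⟨hcube, hq, hT⟩ := forward hek hε hsmall hoff hlin hrec A' h.1 h.2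
    have hwin' : affChart ek E off (πf (extend Z A')) ∈ win ek r := affChart_mem_win hek hrπ h.1
    have harc : q (fun b => expU1 (ek * extend Z A' b)) ∈ arc ek ε := by
      rw [hq]
      intro c
      show |aOf ek (expU1 (ek * (Qm (extend Z A') + θ) c))| < ε
      rw [aOf_expU1 hek.ne' (mul_mem_Ico_of_abs_le hek (by nlinarith : ek * ε < π) (le_of_lt (h.2 c)))]
      exact h.2 c
    rw [Set.indicator_of_mem hcube, Set.indicator_of_mem harc, Set.indicator_of_mem h.2, Pi.one_apply, Pi.one_apply, mul_one, mul_one, hT]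
    by_cases hS : affChart ek E off (πf (extend Z A')) ∈ S
    · rw [Set.indicator_of_mem (s := S ∩ win ek r) ⟨hS, hwin'⟩, Set.indicator_of_mem (s := affChart ek E off ⁻¹' S ∩ box r E off) ⟨hS, h.1⟩]
      rfl
    · rw [Set.indicator_of_notMem (s := S ∩ win ek r) (fun hm => hS hm.1),
        Set.indicator_of_notMem (s := affChart ek E off ⁻¹' S ∩ box r E off) (fun hm => hS hm.1)]
  · have hR : (affChart ek E off ⁻¹' S ∩ box r E off).indicator (1 : (φ → ℝ) → ℝ≥0∞) (πf (extend Z A')) *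
        (arcR ε).indicator (1 : (γ → ℝ) → ℝ≥0∞) (Qm (extend Z A') + θ) = 0 := by
      rcases not_and_or.mp h with h1 | h2
      · rw [Set.indicator_of_notMem (s := affChart ek E off ⁻¹' S ∩ box r E off) (fun hm => h1 hm.2), zero_mul]
      · rw [Set.indicator_of_notMem (s := arcR ε) h2, mul_zero]
    rw [hR]
    by_cases hcube : A' ∈ cube Z ek
    · rw [Set.indicator_of_mem hcube]
      by_cases hwin : transl σ q (fun b => expU1 (ek * extend Z A' b)) ∈ S ∩ win ek r
      · by_cases harc : q (fun b => expU1 (ek * extend Z A' b)) ∈ arc ek ε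
        · exact absurd (backward hek hε hr hsmall hoff hlin hbd hrec A' hcube hwin.2 harc) h
        · rw [Set.indicator_of_notMem harc, mul_zero]
      · rw [Set.indicator_of_notMem hwin, zero_mul]
    · rw [Set.indicator_of_notMem hcube]

end Support

/-! ## §7 The constrained chart law: law of `u′` on the window = `(e_k/2π)^{‖Λ‖}·J ·` (affine-chart image of Lebesgue measure on the box) -/

section Law

variable {ι : Type*} [Fintype ι] (Z : Set ι) [DecidablePred (· ∈ Z)] {γ : Type*} [Fintype γ] (σ : ι → Option γ)
variable (q : (ι → U1) → (γ → U1)) (ek r ε : ℝ)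
variable {φ : Type*} [Fintype φ] (E : Matrix ι φ ℝ) (off : ι → ℝ) (Qm : (ι → ℝ) →ₗ[ℝ] (γ → ℝ)) (θ : γ → ℝ)
variable (πf : (ι → ℝ) →ₗ[ℝ] (φ → ℝ))

omit [DecidablePred (· ∈ Z)] in
/-- kernel: the cube is measurable. [cite: BalabanImbrieJaffe1988, (5.12.3) p.301] -/
theorem measurableSet_cube : MeasurableSet (cube Z ek) := MeasurableSet.univ_pi fun _ => measurableSet_Ioc

/-- kernel: a coordinate of `Ex − off` is measurable in `x`. [cite: BalabanImbrieJaffe1988, (5.12.4) p.301] -/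
theorem measurable_affCoord (b : ι) : Measurable fun x : φ → ℝ => (E *ᵥ x - off) b :=
  ((measurable_pi_apply b).comp (continuous_const.matrix_mulVec continuous_id).measurable).sub measurable_const

/-- kernel: the box is measurable. [cite: BalabanImbrieJaffe1988, (5.12.4) p.301] -/
theorem measurableSet_box : MeasurableSet (box r E off) := by
  have : box r E off = ⋂ b, {x | |(E *ᵥ x - off) b| ≤ r} := by ext x; simp [box]
  rw [this]
  exact MeasurableSet.iInter fun b => measurableSet_le (measurable_affCoord E off b).abs measurable_const

/-- kernel: the affine chart is measurable. [cite: BalabanImbrieJaffe1988, (5.12.4) p.301] -/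
theorem measurable_affChart : Measurable (affChart ek E off) :=
  measurable_pi_iff.mpr fun b => (measurable_expU1_charge ek).comp (measurable_affCoord E off b)

variable {ek ε} in
/-- **The Haar mass of the bump window**: `du{|(ie_k)⁻¹log (Qu)_c| < ε ∀c} = (e_kε/π)^{|C|}` (`du_c = (e_k/2π)dA_c` on one period).
[cite: BalabanImbrieJaffe1988, (5.12.3) p.301] -/
theorem piHaar_arc (hek : 0 < ek) (hεπ : ek * ε < π) :
    (Measure.pi fun _ : γ => (HaarData.haar : Measure U1)) (arc ek ε) = ENNReal.ofReal (ek * ε / π) ^ Fintype.card γ := by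
  have harc : arc (γ := γ) ek ε = Set.pi univ fun _ => {g : U1 | |aOf ek g| < ε} := by ext w; simp [arc]
  rw [harc, Measure.pi_pi]
  simp only [Finset.prod_const, Finset.card_univ]
  congr 1
  have hs : MeasurableSet {g : U1 | |aOf ek g| < ε} := measurableSet_lt (measurable_aOf ek).abs measurable_const
  rw [← (measurePreserving_expU1_charge hek).measure_preimage hs.nullMeasurableSet, Measure.smul_apply,
    Measure.restrict_apply' measurableSet_Ioc, smul_eq_mul]
  have hεlt : ε < π / ek := by rw [lt_div_iff₀ hek]; linarith
  have hset : (fun A => expU1 (ek * A)) ⁻¹' {g : U1 | |aOf ek g| < ε} ∩ Set.Ioc (-π / ek) (π / ek) = Set.Ioo (-ε) ε := by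
    ext A
    simp only [Set.mem_inter_iff, Set.mem_preimage, Set.mem_setOf_eq, Set.mem_Ioc, Set.mem_Ioo]
    constructor
    · rintro ⟨h1, h2, h3⟩
      rcases h3.lt_or_eq with hlt | heq
      · have hIco : ek * A ∈ Set.Ico (-π) π := by
          constructor
          · have := mul_lt_mul_of_pos_left h2 hek
            rw [show ek * (-π / ek) = -π by field_simp] at this
            exact this.le
          · have := mul_lt_mul_of_pos_left hlt hek
            rwa [show ek * (π / ek) = π by field_simp] at this
        rw [aOf_expU1 hek.ne' hIco] at h1
        exact abs_lt.mp h1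
      · exfalso
        rw [heq, show ek * (π / ek) = π by field_simp, expU1_pi_eq_expU1_neg_pi, show -π = ek * (-π / ek) by field_simp,
          aOf_expU1 hek.ne' (by rw [show ek * (-π / ek) = -π by field_simp]; exact ⟨le_rfl, by linarith [Real.pi_pos]⟩),
          abs_div, abs_neg, abs_of_pos Real.pi_pos, abs_of_pos hek] at h1
        exact lt_irrefl _ (h1.trans hεlt)
    · rintro ⟨h1, h2⟩
      refine ⟨?_, by rw [neg_div]; linarith, by linarith⟩
      rw [aOf_expU1 hek.ne' (mul_mem_Ico_of_abs_le hek hεπ (abs_lt.mpr ⟨h1, h2⟩).le)]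
      exact abs_lt.mpr ⟨h1, h2⟩
  rw [hset, Real.volume_Ioo, ← ENNReal.ofReal_mul (by positivity)]
  congr 1
  field_simp
  ring

/-- **THE CONSTANT** `c = (e_k/2π)^{#non-tree} · (du(bump))⁻¹·dA(bump) · J` of the chart law (`= (e_k/2π)^{‖Λ‖}·J`, `chartConst_eq`).
[cite: BalabanImbrieJaffe1988, (5.12.3) p.301] -/
def chartConst (e : ({b : ι // b ∉ Z} → ℝ) ≃ₗ[ℝ] (φ → ℝ) × (γ → ℝ)) : ℝ≥0∞ :=
  ENNReal.ofReal (ek / (2 * π)) ^ Fintype.card {b : ι // b ∉ Z} *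
    (((Measure.pi fun _ : γ => (HaarData.haar : Measure U1)) (arc ek ε))⁻¹ * volume (arcR (γ := γ) ε)) * (jac e : ℝ≥0∞)

variable {Z σ q ek r ε E off Qm θ πf}

/-- **THE CONSTRAINED CHART LAW — the measure-level content of *"the replacement of du^{(k)} with dA^{(k)} for the free variables; for the
constrained variables the replacement is compensated by a removal of the e_k/2π factor from the δ-functions, see (4.6)–(4.8)"* and of the
translation (5.12.4).**  DATA: interior bond index `ι` with tree bonds `Z` (`δ_{Ax}`: `u_b = 1`), block-bond constraints `γ` with the surface
assignment `σ` (`Q^{s*}`), group-valued block averages `q` (exterior configuration frozen inside), charge `e_k > 0`, window `r ≥ 0`, bump `ε > 0`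
with `e_k(r + ε) < π`; HYPOTHESES: covariance `Q(u·Q^{s*}v) = (Qu)·v` and measurability of `q`; EXACT LINEARIZATION on the small fields vanishing
on the tree, `Q(e^{ie_kA}) = e^{ie_k(Q_linA + θ)}` with `|e_k(Q_linA + θ)| < π` there; the algebra of the δ-constraints behind the free coordinates
(`QQ^{s*} = 1`, `QE = 0`, `E` vanishes on the tree, the reading `π` with `πE = 1`, `πQ^{s*} = 0`, and `A = Eπ(A) + Q^{s*}QA` off the tree; no
surface bond is a tree bond); `off = Q^{s*}θ`.  CONCLUSION: the law of the translated interior variables `u′ = u·Q^{s*}(Qu)⁻¹` under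
`Π_b (b ∈ Z ? δ_1 : du_b)`, restricted to the window `{|A(u′_b)| ≤ r ∀b}`, IS `c ·` the image of Lebesgue measure on the unwrapped box
`{x : |(Ex − off)_b| ≤ r}` under the affine chart `x ↦ (e^{ie_k(Ex − off)_b})_b`, `c = chartConst = (e_k/2π)^{‖Λ‖}·J`.
[cite: BalabanImbrieJaffe1988, (5.12.3) p.301] -/
theorem chartLaw (hek : 0 < ek) (hε : 0 < ε) (hr : 0 ≤ r) (hsmall : ek * (r + ε) < π)
    (hσZ : ∀ b ∈ Z, σ b = none) (hoff : ∀ b, off b = sA σ θ b) (hq : Measurable q) (hcov : ∀ u v, q (act σ v u) = q u * v)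
    (hlin : ∀ A : ι → ℝ, (∀ b, |A b| ≤ r + ε) → (∀ b ∈ Z, A b = 0) →
      q (fun b => expU1 (ek * A b)) = fun c => expU1 (ek * (Qm A c + θ c)))
    (hbd : ∀ A : ι → ℝ, (∀ b, |A b| ≤ r + ε) → (∀ b ∈ Z, A b = 0) → ∀ c, |ek * (Qm A c + θ c)| < π)
    (hQS : ∀ w, Qm (sA σ w) = w) (hQE : ∀ x, Qm (E *ᵥ x) = 0) (hEZ : ∀ x, ∀ b ∈ Z, (E *ᵥ x) b = 0)
    (hπE : ∀ x, πf (E *ᵥ x) = x) (hπS : ∀ w, πf (sA σ w) = 0)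
    (hrec : ∀ A : ι → ℝ, (∀ b ∈ Z, A b = 0) → E *ᵥ πf A + sA σ (Qm A) = A) :
    ((Measure.pi (bondLaw Z)).map (transl σ q)).restrict (win ek r) =
      chartConst Z ek ε (freeEquiv hσZ hQS hQE hEZ hπE hπS hrec) • (((volume : Measure (φ → ℝ)).restrict (box r E off)).map (affChart ek E off)) := by
  set e := freeEquiv hσZ hQS hQE hEZ hπE hπS hrec with he_def
  set μ := Measure.pi (bondLaw Z) with hμ
  set W := Measure.pi fun _ : γ => (HaarData.haar : Measure U1) with hW
  have hT : Measurable (transl σ q) := measurable_transl hq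
  have hwin := measurableSet_win (ι := ι) ek r
  have harc := measurableSet_arc (γ := γ) ek ε
  have harcR := measurableSet_arcR (γ := γ) ε
  have hbox := measurableSet_box r E off
  have haff := measurable_affChart ek E off
  have hcubem := measurableSet_cube Z ek
  have hεπ : ek * ε < π := by nlinarith
  have hWarc : W (arc ek ε) = ENNReal.ofReal (ek * ε / π) ^ Fintype.card γ := piHaar_arc hek hεπ
  have hW0 : W (arc ek ε) ≠ 0 := by
    rw [hWarc]; exact pow_ne_zero _ ((ENNReal.ofReal_pos.mpr (by positivity)).ne')
  have hWtop : W (arc ek ε) ≠ ⊤ := by rw [hWarc]; exact ENNReal.pow_ne_top ENNReal.ofReal_ne_top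
  ext S hS
  rw [Measure.restrict_apply hS, Measure.map_apply hT (hS.inter hwin), Measure.smul_apply, Measure.map_apply haff hS,
    Measure.restrict_apply (haff hS), smul_eq_mul]
  -- the windowed indicator of the translated variables, a substitution-invariant function
  set F : (ι → U1) → ℝ≥0∞ := fun u => (S ∩ win ek r).indicator 1 (transl σ q u) with hF
  have hFm : Measurable F := (measurable_one.indicator (hS.inter hwin)).comp hT
  have hFinv : ∀ u v, F (act σ v u) = F u := fun u v => by simp only [hF, transl_act hcov]
  have hGm : Measurable fun w : γ → U1 => (arc ek ε).indicator (1 : (γ → U1) → ℝ≥0∞) w := measurable_one.indicator harc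
  have hFG : Measurable fun u => F u * (arc ek ε).indicator (1 : (γ → U1) → ℝ≥0∞) (q u) := hFm.mul (hGm.comp hq)
  -- step 0: the measure as an integral
  have h0 : μ (transl σ q ⁻¹' (S ∩ win ek r)) = ∫⁻ u, F u ∂μ := by
    rw [← lintegral_indicator_one (hT (hS.inter hwin))]
    rfl
  -- step 1: the bump (independence of `u′` and `Qu`)
  have h1 : ∫⁻ u, F u ∂μ = (W (arc ek ε))⁻¹ * ∫⁻ u, F u * (arc ek ε).indicator (1 : (γ → U1) → ℝ≥0∞) (q u) ∂μ := by
    rw [lintegral_mul_comp_eq Z σ hσZ hq hcov hFm hFinv hGm, lintegral_indicator_one harc, mul_comm (∫⁻ u, F u ∂μ) _, ← mul_assoc,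
      ENNReal.inv_mul_cancel hW0 hWtop, one_mul]
  -- step 2: the chart of this seat's `BIJ88InteriorHaarChart`
  have h2 : ∫⁻ u, F u * (arc ek ε).indicator (1 : (γ → U1) → ℝ≥0∞) (q u) ∂μ =
      ENNReal.ofReal (ek / (2 * π)) ^ Fintype.card {b : ι // b ∉ Z} *
        ∫⁻ A', (cube Z ek).indicator (fun A' => F (fun b => expU1 (ek * extend Z A' b)) *
          (arc ek ε).indicator (1 : (γ → U1) → ℝ≥0∞) (q (fun b => expU1 (ek * extend Z A' b)))) A' := by
    rw [hμ, lintegral_pi_bondLaw_eq_charge Z hek hFG, lintegral_indicator hcubem]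
    congr 1
    refine lintegral_congr fun A' => ?_
    rw [fibreChart_extend]
  -- step 3: the support lemma, pointwise
  have h3 : ∫⁻ A', (cube Z ek).indicator (fun A' => F (fun b => expU1 (ek * extend Z A' b)) *
          (arc ek ε).indicator (1 : (γ → U1) → ℝ≥0∞) (q (fun b => expU1 (ek * extend Z A' b)))) A' =
      ∫⁻ A', (fun p : (φ → ℝ) × (γ → ℝ) => (affChart ek E off ⁻¹' S ∩ box r E off).indicator (1 : (φ → ℝ) → ℝ≥0∞) p.1 *
        (arcR ε).indicator (1 : (γ → ℝ) → ℝ≥0∞) (p.2 + θ)) (e A') :=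
    lintegral_congr fun A' => indicator_eq hek hε hsmall hr hoff hlin hbd hrec S A'
  -- step 4: the linear change of variables and the translation by `θ`
  have hgm : Measurable fun p : (φ → ℝ) × (γ → ℝ) => (affChart ek E off ⁻¹' S ∩ box r E off).indicator (1 : (φ → ℝ) → ℝ≥0∞) p.1 *
      (arcR ε).indicator (1 : (γ → ℝ) → ℝ≥0∞) (p.2 + θ) :=
    ((measurable_one.indicator ((haff hS).inter hbox)).comp measurable_fst).mul
      ((measurable_one.indicator harcR).comp (measurable_snd.add_const θ))
  have h4 : ∫⁻ A', (fun p : (φ → ℝ) × (γ → ℝ) => (affChart ek E off ⁻¹' S ∩ box r E off).indicator (1 : (φ → ℝ) → ℝ≥0∞) p.1 *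
        (arcR ε).indicator (1 : (γ → ℝ) → ℝ≥0∞) (p.2 + θ)) (e A') =
      jac e * ((∫⁻ x, (affChart ek E off ⁻¹' S ∩ box r E off).indicator (1 : (φ → ℝ) → ℝ≥0∞) x) * volume (arcR (γ := γ) ε)) := by
    rw [lintegral_comp_freeEquiv e hgm]
    congr 1
    have hin : ∀ x : φ → ℝ, ∫⁻ w : γ → ℝ, (affChart ek E off ⁻¹' S ∩ box r E off).indicator (1 : (φ → ℝ) → ℝ≥0∞) x *
        (arcR ε).indicator (1 : (γ → ℝ) → ℝ≥0∞) (w + θ) =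
        (affChart ek E off ⁻¹' S ∩ box r E off).indicator (1 : (φ → ℝ) → ℝ≥0∞) x * volume (arcR (γ := γ) ε) := fun x => by
      rw [lintegral_const_mul _ (show Measurable (fun w : γ → ℝ => (arcR ε).indicator (1 : (γ → ℝ) → ℝ≥0∞) (w + θ)) from
          (measurable_one.indicator harcR).comp (measurable_id.add_const θ)),
        lintegral_add_right_eq_self (fun w : γ → ℝ => (arcR ε).indicator (1 : (γ → ℝ) → ℝ≥0∞) w) θ, lintegral_indicator_one harcR]
    rw [lintegral_congr hin, lintegral_mul_const _ (measurable_one.indicator ((haff hS).inter hbox))]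
  -- assemble
  rw [h0, h1, h2, h3, h4, ← lintegral_indicator_one ((haff hS).inter hbox), chartConst]
  ring

/-- **THE CONSTANT IS PRINT'S `(e_k/2π)^{‖Λ‖}` TIMES THE JACOBIAN**: `chartConst = (e_k/2π)^{|φ|}·J` — the `|C|` factors `e_k/2π` of the
constrained variables are *"compensated by a removal of the e_k/2π factor from the δ-functions"* (the bump computation `du(bump) = (e_kε/π)^{|C|}`,
`dA(bump) = (2ε)^{|C|}`), `|φ| = ‖Λ‖ = #non-tree − |C|` by (4.8). [cite: BalabanImbrieJaffe1988, (5.12.3) p.301] -/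
theorem chartConst_eq (hek : 0 < ek) (hε : 0 < ε) (hεπ : ek * ε < π) (e : ({b : ι // b ∉ Z} → ℝ) ≃ₗ[ℝ] (φ → ℝ) × (γ → ℝ)) :
    chartConst Z ek ε e = ENNReal.ofReal ((ek / (2 * π)) ^ Fintype.card φ * jac e) := by
  unfold chartConst
  rw [piHaar_arc hek hεπ, volume_arcR, card_eq_of_freeEquiv e, pow_add,
    ENNReal.ofReal_mul (p := (ek / (2 * π)) ^ Fintype.card φ) (by positivity), ENNReal.ofReal_pow (by positivity : 0 ≤ ek / (2 * π)),
    ENNReal.ofReal_coe_nnreal]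
  have h1 : ENNReal.ofReal (ek / (2 * π)) ^ Fintype.card γ * ENNReal.ofReal (2 * ε) ^ Fintype.card γ =
      ENNReal.ofReal (ek * ε / π) ^ Fintype.card γ := by
    rw [← mul_pow, ← ENNReal.ofReal_mul (by positivity)]
    congr 2
    field_simp
  have hne : ENNReal.ofReal (ek * ε / π) ^ Fintype.card γ ≠ 0 := pow_ne_zero _ ((ENNReal.ofReal_pos.mpr (by positivity)).ne')
  have hnt : ENNReal.ofReal (ek * ε / π) ^ Fintype.card γ ≠ ⊤ := ENNReal.pow_ne_top ENNReal.ofReal_ne_top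
  calc ENNReal.ofReal (ek / (2 * π)) ^ Fintype.card φ * ENNReal.ofReal (ek / (2 * π)) ^ Fintype.card γ *
        ((ENNReal.ofReal (ek * ε / π) ^ Fintype.card γ)⁻¹ * ENNReal.ofReal (2 * ε) ^ Fintype.card γ) * (jac e : ℝ≥0∞)
      = ENNReal.ofReal (ek / (2 * π)) ^ Fintype.card φ * (jac e : ℝ≥0∞) *
          ((ENNReal.ofReal (ek * ε / π) ^ Fintype.card γ)⁻¹ *
            (ENNReal.ofReal (ek / (2 * π)) ^ Fintype.card γ * ENNReal.ofReal (2 * ε) ^ Fintype.card γ)) := by ring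
    _ = ENNReal.ofReal (ek / (2 * π)) ^ Fintype.card φ * (jac e : ℝ≥0∞) := by rw [h1, ENNReal.inv_mul_cancel hne hnt, mul_one]

/-- **THE CONSTRAINED CHART LAW WITH PRINT'S CONSTANT** `(e_k/2π)^{‖Λ‖}·J` — the form consumed by this seat's `BIJ88Eq5127GaugeSector.HChart`
(`ENNReal.ofReal c •` the affine-chart image of Lebesgue measure on the box). [cite: BalabanImbrieJaffe1988, (5.12.3) p.301] -/
theorem chartLaw_ofReal (hek : 0 < ek) (hε : 0 < ε) (hr : 0 ≤ r) (hsmall : ek * (r + ε) < π)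
    (hσZ : ∀ b ∈ Z, σ b = none) (hoff : ∀ b, off b = sA σ θ b) (hq : Measurable q) (hcov : ∀ u v, q (act σ v u) = q u * v)
    (hlin : ∀ A : ι → ℝ, (∀ b, |A b| ≤ r + ε) → (∀ b ∈ Z, A b = 0) →
      q (fun b => expU1 (ek * A b)) = fun c => expU1 (ek * (Qm A c + θ c)))
    (hbd : ∀ A : ι → ℝ, (∀ b, |A b| ≤ r + ε) → (∀ b ∈ Z, A b = 0) → ∀ c, |ek * (Qm A c + θ c)| < π)
    (hQS : ∀ w, Qm (sA σ w) = w) (hQE : ∀ x, Qm (E *ᵥ x) = 0) (hEZ : ∀ x, ∀ b ∈ Z, (E *ᵥ x) b = 0)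
    (hπE : ∀ x, πf (E *ᵥ x) = x) (hπS : ∀ w, πf (sA σ w) = 0)
    (hrec : ∀ A : ι → ℝ, (∀ b ∈ Z, A b = 0) → E *ᵥ πf A + sA σ (Qm A) = A) :
    ((Measure.pi (bondLaw Z)).map (transl σ q)).restrict (win ek r) =
      ENNReal.ofReal ((ek / (2 * π)) ^ Fintype.card φ * jac (freeEquiv hσZ hQS hQE hEZ hπE hπS hrec)) •
        (((volume : Measure (φ → ℝ)).restrict (box r E off)).map (affChart ek E off)) := by
  rw [chartLaw hek hε hr hsmall hσZ hoff hq hcov hlin hbd hQS hQE hEZ hπE hπS hrec, chartConst_eq hek hε (by nlinarith)]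

end Law

/-! ## §8 Canonical free coordinates: a basis of the space of free integrations, and the chart law with no linear-algebra hypothesis left -/

section Canonical

variable {ι : Type*} (Z : Set ι) {γ : Type*} (σ : ι → Option γ) (Qm : (ι → ℝ) →ₗ[ℝ] (γ → ℝ))

/-- the fields vanishing on the tree bonds (`δ_{Ax}` in the Lie algebra). [cite: BalabanImbrieJaffe1988, (4.6) p.275] -/
def treeZero : Submodule ℝ (ι → ℝ) where
  carrier := {A | ∀ b ∈ Z, A b = 0}
  add_mem' {A B} hA hB := fun b hb => by simp only [Pi.add_apply, hA b hb, hB b hb, add_zero]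
  zero_mem' := fun _ _ => rfl
  smul_mem' t {A} hA := fun b hb => by simp only [Pi.smul_apply, hA b hb, smul_eq_mul, mul_zero]

/-- **THE SPACE OF FREE INTEGRATIONS** of (4.6)/(5.12.3): fields on the interior bonds vanishing on the tree bonds (`δ_{Ax}`) with vanishing
linearized block averages (`δ(QA)`) — r18's `BIJ88FreeCount48.free48` on the torus. [cite: BalabanImbrieJaffe1988, (4.8) p.275] -/
def freeSpace : Submodule ℝ (ι → ℝ) := LinearMap.ker Qm ⊓ treeZero Z

/-- kernel: membership in the space of free integrations. [cite: BalabanImbrieJaffe1988, (4.8) p.275] -/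
theorem mem_freeSpace {A : ι → ℝ} : A ∈ freeSpace Z Qm ↔ Qm A = 0 ∧ ∀ b ∈ Z, A b = 0 := by
  simp only [freeSpace, Submodule.mem_inf, LinearMap.mem_ker]
  rfl

/-- **`‖Λ‖`** — the number of free integrations (the dimension of the space of free integrations). [cite: BalabanImbrieJaffe1988, (4.8) p.275] -/
def nFree : ℕ := Module.finrank ℝ (freeSpace Z Qm)

variable {Z σ} in
/-- kernel: `Q^{s*}w` vanishes on the tree (no surface bond is a tree bond). [cite: BalabanImbrieJaffe1988, (5.12.4) p.301] -/
theorem sA_apply_of_mem_tree (hσZ : ∀ b ∈ Z, σ b = none) (w : γ → ℝ) {b : ι} (hb : b ∈ Z) : sA σ w b = 0 :=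
  sA_apply_of_eq_none (hσZ b hb) w

variable [DecidablePred (· ∈ Z)]

/-- zeroing a field on the tree bonds (linear). [cite: BalabanImbrieJaffe1988, (4.6) p.275] -/
def zeroOut : (ι → ℝ) →ₗ[ℝ] (ι → ℝ) where
  toFun A := fun b => if b ∈ Z then 0 else A b
  map_add' A B := by funext b; simp only [Pi.add_apply]; split_ifs <;> simp
  map_smul' t A := by funext b; simp only [Pi.smul_apply, smul_eq_mul, RingHom.id_apply]; split_ifs <;> simp

/-- kernel: zeroing on the tree, pointwise. [cite: BalabanImbrieJaffe1988, (4.6) p.275] -/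
theorem zeroOut_apply (A : ι → ℝ) (b : ι) : zeroOut Z A b = if b ∈ Z then 0 else A b := rfl

/-- kernel: a field vanishing on the tree is unchanged. [cite: BalabanImbrieJaffe1988, (4.6) p.275] -/
theorem zeroOut_of_zero {A : ι → ℝ} (hA : ∀ b ∈ Z, A b = 0) : zeroOut Z A = A := by
  funext b; rw [zeroOut_apply]; split_ifs with h; exacts [(hA b h).symm, rfl]

/-- **THE PROJECTION `A ↦ A − Q^{s*}QA` ONTO THE FREE SPACE** (the translation (5.12.4) read on the interior, after zeroing the tree bonds).
[cite: BalabanImbrieJaffe1988, (5.12.4) p.301] -/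
def projFree (hσZ : ∀ b ∈ Z, σ b = none) (hQS : ∀ w, Qm (sA σ w) = w) : (ι → ℝ) →ₗ[ℝ] freeSpace Z Qm :=
  LinearMap.codRestrict (freeSpace Z Qm) ((LinearMap.id - sAL σ ∘ₗ Qm) ∘ₗ zeroOut Z) fun A => by
    rw [mem_freeSpace]
    constructor
    · simp only [LinearMap.comp_apply, LinearMap.sub_apply, LinearMap.id_apply, sAL_apply, map_sub, hQS, sub_self]
    · intro b hb
      simp only [LinearMap.comp_apply, LinearMap.sub_apply, LinearMap.id_apply, sAL_apply, Pi.sub_apply, zeroOut_apply, if_pos hb,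
        sA_apply_of_mem_tree hσZ _ hb, sub_zero]

/-- kernel: the projection is `A ↦ A − Q^{s*}QA` after zeroing the tree. [cite: BalabanImbrieJaffe1988, (5.12.4) p.301] -/
theorem projFree_apply_coe (hσZ : ∀ b ∈ Z, σ b = none) (hQS : ∀ w, Qm (sA σ w) = w) (A : ι → ℝ) :
    ((projFree Z σ Qm hσZ hQS A : freeSpace Z Qm) : ι → ℝ) = zeroOut Z A - sA σ (Qm (zeroOut Z A)) := rfl

variable [Fintype ι]

/-- a basis of the space of free integrations. [cite: BalabanImbrieJaffe1988, (4.8) p.275] -/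
def freeBasis : Module.Basis (Fin (nFree Z Qm)) ℝ (freeSpace Z Qm) := Module.finBasis ℝ (freeSpace Z Qm)

/-- **THE MATRIX `E` OF FREE COORDINATES**: its columns are a basis of the space of free integrations. [cite: BalabanImbrieJaffe1988, (4.8) p.275] -/
def Emat : Matrix ι (Fin (nFree Z Qm)) ℝ := fun b i => ((freeBasis Z Qm i : freeSpace Z Qm) : ι → ℝ) b

omit [DecidablePred (· ∈ Z)] in
/-- kernel: `Ex` is the field with coordinates `x` in the basis. [cite: BalabanImbrieJaffe1988, (4.8) p.275] -/
theorem Emat_mulVec (x : Fin (nFree Z Qm) → ℝ) :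
    Emat Z Qm *ᵥ x = (((freeBasis Z Qm).equivFun.symm x : freeSpace Z Qm) : ι → ℝ) := by
  funext b
  rw [Module.Basis.equivFun_symm_apply, Submodule.coe_sum, Finset.sum_apply]
  simp only [Matrix.mulVec, dotProduct, Emat, Submodule.coe_smul, Pi.smul_apply, smul_eq_mul]
  exact Finset.sum_congr rfl fun i _ => mul_comm _ _

omit [DecidablePred (· ∈ Z)] in
/-- kernel: `Ex` is a free integration. [cite: BalabanImbrieJaffe1988, (4.8) p.275] -/
theorem Emat_mulVec_mem (x : Fin (nFree Z Qm) → ℝ) : Emat Z Qm *ᵥ x ∈ freeSpace Z Qm := by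
  rw [Emat_mulVec]; exact Subtype.mem _

omit [DecidablePred (· ∈ Z)] in
/-- kernel: `QE = 0`. [cite: BalabanImbrieJaffe1988, (4.8) p.275] -/
theorem Qm_Emat_mulVec (x : Fin (nFree Z Qm) → ℝ) : Qm (Emat Z Qm *ᵥ x) = 0 :=
  ((mem_freeSpace Z Qm).mp (Emat_mulVec_mem Z Qm x)).1

omit [DecidablePred (· ∈ Z)] in
/-- kernel: `E` vanishes on the tree bonds. [cite: BalabanImbrieJaffe1988, (4.8) p.275] -/
theorem Emat_mulVec_apply_of_mem (x : Fin (nFree Z Qm) → ℝ) {b : ι} (hb : b ∈ Z) : (Emat Z Qm *ᵥ x) b = 0 :=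
  ((mem_freeSpace Z Qm).mp (Emat_mulVec_mem Z Qm x)).2 b hb

/-- **THE FREE-COORDINATE READING `π`**: coordinates of `A − Q^{s*}QA` in the basis `E`. [cite: BalabanImbrieJaffe1988, (4.8) p.275] -/
def πfree (hσZ : ∀ b ∈ Z, σ b = none) (hQS : ∀ w, Qm (sA σ w) = w) : (ι → ℝ) →ₗ[ℝ] (Fin (nFree Z Qm) → ℝ) :=
  (freeBasis Z Qm).equivFun.toLinearMap ∘ₗ projFree Z σ Qm hσZ hQS

variable {Z σ Qm}

/-- kernel: the reading is the basis coordinates of the projection. [cite: BalabanImbrieJaffe1988, (4.8) p.275] -/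
theorem πfree_apply (hσZ : ∀ b ∈ Z, σ b = none) (hQS : ∀ w, Qm (sA σ w) = w) (A : ι → ℝ) :
    πfree Z σ Qm hσZ hQS A = (freeBasis Z Qm).equivFun (projFree Z σ Qm hσZ hQS A) := rfl

/-- kernel: `πE = 1`. [cite: BalabanImbrieJaffe1988, (4.8) p.275] -/
theorem πfree_Emat (hσZ : ∀ b ∈ Z, σ b = none) (hQS : ∀ w, Qm (sA σ w) = w) (x : Fin (nFree Z Qm) → ℝ) :
    πfree Z σ Qm hσZ hQS (Emat Z Qm *ᵥ x) = x := by
  have h0 : sA σ (0 : γ → ℝ) = 0 := by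
    have := sA_smul σ (0 : ℝ) (0 : γ → ℝ); simpa using this
  have hproj : projFree Z σ Qm hσZ hQS (Emat Z Qm *ᵥ x) = (freeBasis Z Qm).equivFun.symm x := by
    apply Subtype.ext
    rw [projFree_apply_coe, zeroOut_of_zero Z (fun b hb => Emat_mulVec_apply_of_mem Z Qm x hb), Qm_Emat_mulVec, Emat_mulVec, h0, sub_zero]
  rw [πfree_apply, hproj, LinearEquiv.apply_symm_apply]

/-- kernel: `πQ^{s*} = 0`. [cite: BalabanImbrieJaffe1988, (4.8) p.275] -/
theorem πfree_sA (hσZ : ∀ b ∈ Z, σ b = none) (hQS : ∀ w, Qm (sA σ w) = w) (w : γ → ℝ) : πfree Z σ Qm hσZ hQS (sA σ w) = 0 := by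
  have hproj : projFree Z σ Qm hσZ hQS (sA σ w) = 0 := by
    apply Subtype.ext
    rw [projFree_apply_coe, zeroOut_of_zero Z (fun b hb => sA_apply_of_mem_tree hσZ w hb), hQS, sub_self]
    rfl
  rw [πfree_apply, hproj, map_zero]

/-- **`A = Eπ(A) + Q^{s*}QA` for every field vanishing on the tree** — the decomposition behind the free coordinates.
[cite: BalabanImbrieJaffe1988, (5.12.4) p.301] -/
theorem Emat_πfree_add (hσZ : ∀ b ∈ Z, σ b = none) (hQS : ∀ w, Qm (sA σ w) = w) {A : ι → ℝ} (hA : ∀ b ∈ Z, A b = 0) :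
    Emat Z Qm *ᵥ πfree Z σ Qm hσZ hQS A + sA σ (Qm A) = A := by
  have h1 : Emat Z Qm *ᵥ πfree Z σ Qm hσZ hQS A = ((projFree Z σ Qm hσZ hQS A : freeSpace Z Qm) : ι → ℝ) := by
    rw [Emat_mulVec, πfree_apply, LinearEquiv.symm_apply_apply]
  rw [h1, projFree_apply_coe, zeroOut_of_zero Z hA, sub_add_cancel]

/-- the canonical free-coordinate equivalence (no hypothesis beyond `QQ^{s*} = 1` and *no surface bond on the tree*).
[cite: BalabanImbrieJaffe1988, (4.8) p.275] -/
def freeEquivCanonical [Fintype γ] (hσZ : ∀ b ∈ Z, σ b = none) (hQS : ∀ w, Qm (sA σ w) = w) :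
    ({b : ι // b ∉ Z} → ℝ) ≃ₗ[ℝ] (Fin (nFree Z Qm) → ℝ) × (γ → ℝ) :=
  freeEquiv (E := Emat Z Qm) (πf := πfree Z σ Qm hσZ hQS) hσZ hQS (Qm_Emat_mulVec Z Qm) (fun x _ hb => Emat_mulVec_apply_of_mem Z Qm x hb)
    (πfree_Emat hσZ hQS) (πfree_sA hσZ hQS) (fun _ hA => Emat_πfree_add hσZ hQS hA)

/-- **(4.8) WITH NO HYPOTHESIS LEFT BUT `QQ^{s*} = 1`**: `#(non-tree interior bonds) = ‖Λ‖ + |Λ′^{c*c}|`. [cite: BalabanImbrieJaffe1988, (4.8) p.275] -/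
theorem card_notMem_tree_eq [Fintype γ] (hσZ : ∀ b ∈ Z, σ b = none) (hQS : ∀ w, Qm (sA σ w) = w) :
    Fintype.card {b : ι // b ∉ Z} = nFree Z Qm + Fintype.card γ := by
  simpa using card_eq_of_freeEquiv (freeEquivCanonical hσZ hQS)

variable [Fintype γ] {q : (ι → U1) → (γ → U1)} {ek r ε : ℝ} {θ : γ → ℝ}

/-- **THE CONSTRAINED CHART LAW IN CANONICAL FREE COORDINATES** — `chartLaw_ofReal` with `E` the basis matrix of the space of free integrations
and offset `Q^{s*}θ`; hypotheses: the numerics, covariance and measurability of the block averages, the exact linearization on the small fields,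
`QQ^{s*} = 1`, no surface bond on the tree.  Constant `(e_k/2π)^{‖Λ‖}·J`. [cite: BalabanImbrieJaffe1988, (5.12.3) p.301] -/
theorem chartLaw_canonical (hek : 0 < ek) (hε : 0 < ε) (hr : 0 ≤ r) (hsmall : ek * (r + ε) < π)
    (hσZ : ∀ b ∈ Z, σ b = none) (hq : Measurable q) (hcov : ∀ u v, q (act σ v u) = q u * v)
    (hlin : ∀ A : ι → ℝ, (∀ b, |A b| ≤ r + ε) → (∀ b ∈ Z, A b = 0) →
      q (fun b => expU1 (ek * A b)) = fun c => expU1 (ek * (Qm A c + θ c)))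
    (hbd : ∀ A : ι → ℝ, (∀ b, |A b| ≤ r + ε) → (∀ b ∈ Z, A b = 0) → ∀ c, |ek * (Qm A c + θ c)| < π)
    (hQS : ∀ w, Qm (sA σ w) = w) :
    ((Measure.pi (bondLaw Z)).map (transl σ q)).restrict (win ek r) =
      ENNReal.ofReal ((ek / (2 * π)) ^ nFree Z Qm * jac (freeEquivCanonical hσZ hQS)) •
        (((volume : Measure (Fin (nFree Z Qm) → ℝ)).restrict (box r (Emat Z Qm) (sA σ θ))).map (affChart ek (Emat Z Qm) (sA σ θ))) := by
  have h := chartLaw_ofReal (E := Emat Z Qm) (off := sA σ θ) (πf := πfree Z σ Qm hσZ hQS) hek hε hr hsmall hσZ (fun _ => rfl) hq hcov hlin hbd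
    hQS (Qm_Emat_mulVec Z Qm) (fun x _ hb => Emat_mulVec_apply_of_mem Z Qm x hb) (πfree_Emat hσZ hQS) (πfree_sA hσZ hQS)
    (fun _ hA => Emat_πfree_add hσZ hQS hA)
  rw [Fintype.card_fin] at h
  exact h

end Canonical

end

end Literature.MathematicalPhysics.QuantumFieldTheory.BalabanImbrieJaffe1984to88.BIJ88FreeCoordinates48
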